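import Literature.NumberTheory.EllipticCurves.NeronModelAbelianSchemeProofs
import Literature.AlgebraicGeometry.Morphisms.FlatBirationalOpenImmersion
import Literature.AlgebraicGeometry.Resolution.ReducedOfSmoothOverReduced
import Literature.AlgebraicGeometry.Morphisms.SpecialFibreGenericPoint
import Literature.AlgebraicGeometry.GroupSchemes.GrpObjShear
import Literature.NumberTheory.EllipticCurves.GenericFibreOpenImmersion
import Literature.AlgebraicGeometry.GroupSchemes.BirationalGroupLawSwap
import Literature.AlgebraicGeometry.Morphisms.ZariskiLocalOnSupOfOpens
import Literature.AlgebraicGeometry.Motives.AbelianVarietyProofs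
import Literature.NumberTheory.DiophantineGeometry.SmoothProperModelBirationalGroupLawCore
import Mathlib.AlgebraicGeometry.Geometrically.Irreducible
import HarnessLib

/-!
# The group law of the generic fibre is an `R`-birational group law on a smooth proper model

Topic: `Literature/NumberTheory/DiophantineGeometry`. THEOREMS ONLY (no definition, no named
fact, no instance, no `sorry`). Cell `hodgecm-mathlib` (D-0151), road W toward the floor binder
r₀ (`exists_isAbelianSchemeModel_of_hasGoodReductionAt`), node **(W0)** of B-plan1's `R0-SPEC`:
banked capital, no floor change.

Let `R` be a discrete valuation ring with fraction field `K`, `𝒳 → Spec R` smooth, proper, with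
geometrically irreducible fibres, and `e : 𝒳_K ≅ E` an identification of the generic fibre with
a `K`-group scheme `E`. Then the group law of `E` extends to an `R`-birational group law on `𝒳`
(Edixhoven–Romagny, arXiv:1204.1799v2, Thm. 6.3; Bosch–Lütkebohmert–Raynaud §4.3 with
Def. 5.1/1): there are an open `U ⊆ 𝒳 ×_R 𝒳` containing the generic fibre and meeting the
special fibre, and an `R`-morphism `m : U → 𝒳` restricting to the multiplication of `E`, such
that `Φ = (pr₁, m)` and `Ψ = (m, pr₂) : U → 𝒳 ×_R 𝒳` are open immersions with `R`-dense image
(`exists_birationalGroupLaw_of_smooth_proper`).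

## Proof (assembly of the cell's (W0) leaves; B-p18 `W0-SPEC`)

`U₀ :=` the generic-fibre open of `Y := 𝒳 ⊗ 𝒳`; `g₀ : U₀ → 𝒳` the multiplication read through
`e`; `D ⊇ U₀` the domain of definition of the rational map it defines and `m : D → 𝒳` its maximal
extension (tree `NeronModelWeilDomain`); `ξ ∈ D` the generic point of the special fibre of `Y`
(★ `Morphisms.exists_generic_specialFibre`, in `D` by ★ `mem_domain_of_ringKrullDim_le_one`).
The ÉTALE HEART (★ `SmoothProperModelBirationalGroupLawCore.core_fst`, B-p18 and hands): `Φ` is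
flat and locally of finite presentation on an open `V ∋ ξ`; its twin for `Ψ` follows by the
swap (★ `BirationalGroupLawSwap.core_snd_of_core_fst`, B-p01). On `U₀`, `Φ` is the shear
`(x, y) ↦ (x, xy)` of `E ⊗ E` read through `e` and the monoidal structure of the generic-fibre
functor, an isomorphism (★ `GroupSchemes.isIso_lift_fst_mul`, B-p21); so `Φ` is flat + lfp on
`V ⊔ U₀` (Zariski-locality, ★ `Morphisms.of_homOfLE_of_homOfLE`) and an isomorphism over the
generic fibre (★ `Morphisms.isIso_morphismRestrict_of_chart`), hence an OPEN IMMERSION by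
Stacks 081M (★ `isOpenImmersion_of_flat_of_isIso_morphismRestrict_genericFibre`, B-p21).
`U := (V_Φ ⊔ U₀) ⊓ (V_Ψ ⊔ U₀)`.

## References

* B. Edixhoven, M. Romagny, *Group schemes out of birational group laws, Néron models*,
  arXiv:1204.1799v2 (Panoramas et Synthèses 47, 2016), Thm. 6.3. [EdixhovenRomagny2012]
* S. Bosch, W. Lütkebohmert, M. Raynaud, *Néron Models*, Springer 1990, §4.3, Def. 5.1/1.
  [BLRNeronModels1990]
-/

noncomputable section

universe u

namespace Literature.NumberTheory.DiophantineGeometry.SmoothProperModelBirationalGroupLaw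

open CategoryTheory Limits _root_.AlgebraicGeometry MonoidalCategory CartesianMonoidalCategory
open Literature.NumberTheory.EllipticCurves
open Literature.AlgebraicGeometry.Morphisms (of_homOfLE_of_homOfLE isIso_morphismRestrict_of_chart)
open scoped MonObj CategoryTheory.Obj

variable (R : Type u) [CommRing R] [IsDomain R] [IsDiscreteValuationRing R]
  (K : Type u) [Field K] [Algebra R K] [IsFractionRing R K]

variable [IsOpenImmersion (specGenericPoint R K)]

variable (𝒳 : Over (Spec (.of R))) [Smooth 𝒳.hom] [IsProper 𝒳.hom] [GeometricallyIrreducible 𝒳.hom]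
  (E : Over (Spec (.of K))) [GrpObj E] (e : (genericFibre R K).obj 𝒳 ≅ E)




/-! ### Steps 1–4: the objects `U₀, g₀, D, m, ξ` -/

section Assembly

omit [IsDomain R] [IsDiscreteValuationRing R] [IsProper 𝒳.hom] [GeometricallyIrreducible 𝒳.hom] in
/-- Step 2 (i): `𝒳 ⊗ 𝒳 → Spec R` is smooth (★ `smooth_tensorObj_hom_of_smooth`). [folklore] -/
private theorem smooth_tensorObj_hom : Smooth (𝒳 ⊗ 𝒳).hom :=
  smooth_tensorObj_hom_of_smooth ‹_› ‹_›

omit [IsDomain R] [IsDiscreteValuationRing R] [IsProper 𝒳.hom] in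
/-- Step 2 (ii): `𝒳 ⊗ 𝒳 → Spec R` has geometrically irreducible fibres
(`(𝒳 ⊗ 𝒳).hom = pullback.fst ≫ 𝒳.hom`, Mathlib `GeometricallyIrreducible.comp`). [folklore] -/
private theorem geometricallyIrreducible_tensorObj_hom : GeometricallyIrreducible (𝒳 ⊗ 𝒳).hom := by
  rw [Over.tensorObj_hom]
  exact @GeometricallyIrreducible.comp _ _ _ (pullback.fst 𝒳.hom 𝒳.hom) 𝒳.hom
    (MorphismProperty.pullback_fst _ _ inferInstance) inferInstance
    (MorphismProperty.pullback_fst _ _ inferInstance) inferInstance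

omit [IsDomain R] [IsDiscreteValuationRing R] [Smooth 𝒳.hom] [GeometricallyIrreducible 𝒳.hom] in
/-- Step 2 (ii'): `𝒳 ⊗ 𝒳 → Spec R` is quasi-compact (indeed proper). [folklore] -/
private theorem quasiCompact_tensorObj_hom : QuasiCompact (𝒳 ⊗ 𝒳).hom := by
  rw [Over.tensorObj_hom]
  exact MorphismProperty.comp_mem _ _ _ (MorphismProperty.pullback_fst _ _ inferInstance)
    inferInstance

omit [IsDiscreteValuationRing R] [IsProper 𝒳.hom] in
/-- Step 2 (iii): the total space of `𝒳` is irreducible (geometrically irreducible and open over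
the irreducible `Spec R`). [folklore] -/
private theorem irreducibleSpace_left : IrreducibleSpace 𝒳.left :=
  GeometricallyIrreducible.irreducibleSpace 𝒳.hom 𝒳.hom.isOpenMap

omit [IsProper 𝒳.hom] in
/-- Step 2 (iv): the total space of `𝒳 ⊗ 𝒳` is integral (irreducible: Mathlib instance for the
pullback of a geometrically irreducible universally open morphism to an irreducible scheme;
reduced: smooth over the reduced noetherian `Spec R`, ★ `isReduced_of_smooth_of_isReduced_base`). [folklore] -/
private theorem isIntegral_tensorObj_left : IsIntegral (𝒳 ⊗ 𝒳).left := by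
  haveI : Smooth (𝒳 ⊗ 𝒳).hom := smooth_tensorObj_hom R 𝒳
  haveI : IrreducibleSpace 𝒳.left := irreducibleSpace_left R 𝒳
  haveI : GeometricallyIrreducible (pullback.fst 𝒳.hom 𝒳.hom) :=
    MorphismProperty.pullback_fst _ _ inferInstance
  haveI : UniversallyOpen (pullback.fst 𝒳.hom 𝒳.hom) :=
    MorphismProperty.pullback_fst _ _ inferInstance
  haveI : IrreducibleSpace (𝒳 ⊗ 𝒳).left := by
    change IrreducibleSpace ↥(pullback 𝒳.hom 𝒳.hom)
    exact GeometricallyIrreducible.irreducibleSpace (pullback.fst 𝒳.hom 𝒳.hom)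
      (pullback.fst 𝒳.hom 𝒳.hom).isOpenMap
  haveI : _root_.AlgebraicGeometry.IsReduced (𝒳 ⊗ 𝒳).left :=
    Literature.AlgebraicGeometry.Resolution.isReduced_of_smooth_of_isReduced_base (𝒳 ⊗ 𝒳).hom
  exact isIntegral_of_irreducibleSpace_of_isReduced _

omit [IsDomain R] [IsDiscreteValuationRing R] [IsFractionRing R K] [Smooth 𝒳.hom] [IsProper 𝒳.hom] [GeometricallyIrreducible 𝒳.hom] in
/-- Step 1 (range): the generic fibre `pullback (𝒳 ⊗ 𝒳).hom (Spec K → Spec R)` and the open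
`genericOpen` have the same image in the total space. [folklore] -/
private theorem range_pullbackFst_eq_range_genericFibreOpen_ι :
    Set.range (pullback.fst (𝒳 ⊗ 𝒳).hom (specGenericPoint R K)).base =
      Set.range ((𝒳 ⊗ 𝒳).hom ⁻¹ᵁ (specGenericPoint R K).opensRange).ι.base := by
  rw [Scheme.Opens.range_ι]
  exact IsOpenImmersion.range_pullbackFst (specGenericPoint R K) (𝒳 ⊗ 𝒳).hom


omit [IsDomain R] [IsDiscreteValuationRing R] [IsFractionRing R K] [IsOpenImmersion (specGenericPoint R K)] in
/-- For a morphism `v : A_K → B_K` of generic fibres, `v.left ≫ pr_B ≫ B.hom = pr_A ≫ A.hom`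
(both are the structure map of `A_K` to `Spec R`). [folklore] -/
private theorem left_fst_comp_hom {A B : Over (Spec (.of R))}
    (v : (genericFibre R K).obj A ⟶ (genericFibre R K).obj B) :
    v.left ≫ pullback.fst B.hom (specGenericPoint R K) ≫ B.hom =
      pullback.fst A.hom (specGenericPoint R K) ≫ A.hom := by
  have h1 : v.left ≫ ((genericFibre R K).obj B).hom = ((genericFibre R K).obj A).hom := Over.w v
  have hB : pullback.fst B.hom (specGenericPoint R K) ≫ B.hom =
      ((genericFibre R K).obj B).hom ≫ specGenericPoint R K := pullback.condition
  have hA : pullback.fst A.hom (specGenericPoint R K) ≫ A.hom =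
      ((genericFibre R K).obj A).hom ≫ specGenericPoint R K := pullback.condition
  calc v.left ≫ pullback.fst B.hom (specGenericPoint R K) ≫ B.hom
      = v.left ≫ (((genericFibre R K).obj B).hom ≫ specGenericPoint R K) := by
        exact congrArg (v.left ≫ ·) hB
    _ = (v.left ≫ ((genericFibre R K).obj B).hom) ≫ specGenericPoint R K :=
        (Category.assoc _ _ _).symm
    _ = ((genericFibre R K).obj A).hom ≫ specGenericPoint R K := by rw [h1]
    _ = pullback.fst A.hom (specGenericPoint R K) ≫ A.hom := hA.symm

omit [IsDomain R] [IsDiscreteValuationRing R] [IsFractionRing R K] [Smooth 𝒳.hom] [IsProper 𝒳.hom] [GeometricallyIrreducible 𝒳.hom] in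
/-- Step 1 (`hg₀`): the generic-fibre multiplication, read on the open `genericOpen ⊆ 𝒳 ⊗ 𝒳`
through `e₀ := isoOfRangeEq` and `e`, namely
`g₀ = e₀⁻¹ ≫ (δ ≫ (e ⊗ e) ≫ μ ≫ e⁻¹).left ≫ pr : genericOpen → 𝒳`, is a morphism over `Spec R`. [folklore] -/
private theorem genericMul_comp_hom :
    ((IsOpenImmersion.isoOfRangeEq (pullback.fst (𝒳 ⊗ 𝒳).hom (specGenericPoint R K))
          ((𝒳 ⊗ 𝒳).hom ⁻¹ᵁ (specGenericPoint R K).opensRange).ι (range_pullbackFst_eq_range_genericFibreOpen_ι R K 𝒳)).inv ≫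
        (Functor.OplaxMonoidal.δ (genericFibre R K) 𝒳 𝒳 ≫ (e.hom ⊗ₘ e.hom) ≫ μ[E] ≫ e.inv).left ≫
        pullback.fst 𝒳.hom (specGenericPoint R K)) ≫ 𝒳.hom =
      ((𝒳 ⊗ 𝒳).hom ⁻¹ᵁ (specGenericPoint R K).opensRange).ι ≫ (𝒳 ⊗ 𝒳).hom := by
  have he₀' := IsOpenImmersion.isoOfRangeEq_inv_fac (pullback.fst (𝒳 ⊗ 𝒳).hom (specGenericPoint R K))
    ((𝒳 ⊗ 𝒳).hom ⁻¹ᵁ (specGenericPoint R K).opensRange).ι (range_pullbackFst_eq_range_genericFibreOpen_ι R K 𝒳)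
  have key := left_fst_comp_hom R K
    (Functor.OplaxMonoidal.δ (genericFibre R K) 𝒳 𝒳 ≫ (e.hom ⊗ₘ e.hom) ≫ μ[E] ≫ e.inv)
  calc ((IsOpenImmersion.isoOfRangeEq (pullback.fst (𝒳 ⊗ 𝒳).hom (specGenericPoint R K))
          ((𝒳 ⊗ 𝒳).hom ⁻¹ᵁ (specGenericPoint R K).opensRange).ι (range_pullbackFst_eq_range_genericFibreOpen_ι R K 𝒳)).inv ≫
        (Functor.OplaxMonoidal.δ (genericFibre R K) 𝒳 𝒳 ≫ (e.hom ⊗ₘ e.hom) ≫ μ[E] ≫ e.inv).left ≫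
        pullback.fst 𝒳.hom (specGenericPoint R K)) ≫ 𝒳.hom
      = (IsOpenImmersion.isoOfRangeEq (pullback.fst (𝒳 ⊗ 𝒳).hom (specGenericPoint R K))
          ((𝒳 ⊗ 𝒳).hom ⁻¹ᵁ (specGenericPoint R K).opensRange).ι (range_pullbackFst_eq_range_genericFibreOpen_ι R K 𝒳)).inv ≫
        ((Functor.OplaxMonoidal.δ (genericFibre R K) 𝒳 𝒳 ≫ (e.hom ⊗ₘ e.hom) ≫ μ[E] ≫ e.inv).left ≫
        pullback.fst 𝒳.hom (specGenericPoint R K) ≫ 𝒳.hom) := by simp only [Category.assoc]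
    _ = (IsOpenImmersion.isoOfRangeEq (pullback.fst (𝒳 ⊗ 𝒳).hom (specGenericPoint R K))
          ((𝒳 ⊗ 𝒳).hom ⁻¹ᵁ (specGenericPoint R K).opensRange).ι (range_pullbackFst_eq_range_genericFibreOpen_ι R K 𝒳)).inv ≫
        (pullback.fst (𝒳 ⊗ 𝒳).hom (specGenericPoint R K) ≫ (𝒳 ⊗ 𝒳).hom) := by
        exact congrArg (_ ≫ ·) key
    _ = ((IsOpenImmersion.isoOfRangeEq (pullback.fst (𝒳 ⊗ 𝒳).hom (specGenericPoint R K))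
          ((𝒳 ⊗ 𝒳).hom ⁻¹ᵁ (specGenericPoint R K).opensRange).ι (range_pullbackFst_eq_range_genericFibreOpen_ι R K 𝒳)).inv ≫
        pullback.fst (𝒳 ⊗ 𝒳).hom (specGenericPoint R K)) ≫ (𝒳 ⊗ 𝒳).hom :=
        (Category.assoc _ _ _).symm
    _ = ((𝒳 ⊗ 𝒳).hom ⁻¹ᵁ (specGenericPoint R K).opensRange).ι ≫ (𝒳 ⊗ 𝒳).hom := by exact congrArg (· ≫ (𝒳 ⊗ 𝒳).hom) he₀'

omit [IsDomain R] [IsDiscreteValuationRing R] [IsFractionRing R K] [Smooth 𝒳.hom] [IsProper 𝒳.hom] [GeometricallyIrreducible 𝒳.hom] in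
/-- Step 1 (density): `genericOpen` contains the generic fibre (tautologically) … [folklore] -/
private theorem preimage_range_subset_genericFibreOpen :
    (𝒳 ⊗ 𝒳).hom.base ⁻¹' Set.range (specGenericPoint R K).base ⊆
      (((𝒳 ⊗ 𝒳).hom ⁻¹ᵁ (specGenericPoint R K).opensRange) : Set (𝒳 ⊗ 𝒳).left) := by
  rintro x ⟨y, hy⟩
  exact ⟨y, hy⟩

omit [IsProper 𝒳.hom] in
/-- … hence is dense in the integral total space of `𝒳 ⊗ 𝒳`. [folklore] -/
private theorem dense_genericFibreOpen : Dense (((𝒳 ⊗ 𝒳).hom ⁻¹ᵁ (specGenericPoint R K).opensRange) : Set (𝒳 ⊗ 𝒳).left) := by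
  haveI : Smooth (𝒳 ⊗ 𝒳).hom := smooth_tensorObj_hom R 𝒳
  haveI : IsIntegral (𝒳 ⊗ 𝒳).left := isIntegral_tensorObj_left R 𝒳
  have hη : genericPoint (𝒳 ⊗ 𝒳).left ∈ ((𝒳 ⊗ 𝒳).hom ⁻¹ᵁ (specGenericPoint R K).opensRange) :=
    genericPoint_mem_of_preimage_subset (K := K) (preimage_range_subset_genericFibreOpen R K 𝒳)
  exact (((𝒳 ⊗ 𝒳).hom ⁻¹ᵁ (specGenericPoint R K).opensRange)).2.dense ⟨_, hη⟩

/-- **Steps 1, 3, 4 packaged.** The domain of definition `D` of the rational map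
`𝒳 ⊗ 𝒳 ⇢ 𝒳` defined by the generic-fibre multiplication `g₀`, its maximal extension `m` (an
`R`-morphism restricting to `g₀`), and a point `ξ ∈ D` over the closed point with
`dim 𝒪_{𝒳 ⊗ 𝒳, ξ} ≤ 1` specialising to the whole special fibre (leaf L1 ★ `exists_generic_specialFibre`
through `stub_L1`, and ★ `mem_domain_of_ringKrullDim_le_one`). These are exactly the arguments
`core_fst` consumes. [folklore] -/
private theorem exists_mulDomain :
    ∃ (D : (𝒳 ⊗ 𝒳).left.Opens) (hD : (𝒳 ⊗ 𝒳).hom ⁻¹ᵁ (specGenericPoint R K).opensRange ≤ D)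
      (m : (D : Scheme.{u}) ⟶ 𝒳.left) (_ : m ≫ 𝒳.hom = D.ι ≫ (𝒳 ⊗ 𝒳).hom),
      (𝒳 ⊗ 𝒳).left.homOfLE hD ≫ m =
        (IsOpenImmersion.isoOfRangeEq (pullback.fst (𝒳 ⊗ 𝒳).hom (specGenericPoint R K))
            ((𝒳 ⊗ 𝒳).hom ⁻¹ᵁ (specGenericPoint R K).opensRange).ι (by
              rw [Scheme.Opens.range_ι]
              exact IsOpenImmersion.range_pullbackFst (specGenericPoint R K) (𝒳 ⊗ 𝒳).hom)).inv ≫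
          (Functor.OplaxMonoidal.δ (genericFibre R K) 𝒳 𝒳 ≫ (e.hom ⊗ₘ e.hom) ≫ μ[E] ≫ e.inv).left ≫
          pullback.fst 𝒳.hom (specGenericPoint R K) ∧
      ∃ ξ : (𝒳 ⊗ 𝒳).left, ξ ∈ D ∧ (𝒳 ⊗ 𝒳).hom.base ξ = IsLocalRing.closedPoint R ∧
        ringKrullDim ((𝒳 ⊗ 𝒳).left.presheaf.stalk ξ) ≤ 1 ∧
        ∀ y : (𝒳 ⊗ 𝒳).left, (𝒳 ⊗ 𝒳).hom.base y = IsLocalRing.closedPoint R → ξ ⤳ y := by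
  haveI : Smooth (𝒳 ⊗ 𝒳).hom := smooth_tensorObj_hom R 𝒳
  haveI : IsIntegral (𝒳 ⊗ 𝒳).left := isIntegral_tensorObj_left R 𝒳
  haveI : GeometricallyIrreducible (𝒳 ⊗ 𝒳).hom := geometricallyIrreducible_tensorObj_hom R 𝒳
  haveI : QuasiCompact (𝒳 ⊗ 𝒳).hom := quasiCompact_tensorObj_hom R 𝒳
  haveI : IsSeparated 𝒳.hom := inferInstance
  -- step 1
  set U₀ : (𝒳 ⊗ 𝒳).left.Opens := ((𝒳 ⊗ 𝒳).hom ⁻¹ᵁ (specGenericPoint R K).opensRange) with hU₀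
  set g₀ : (U₀ : Scheme.{u}) ⟶ 𝒳.left :=
    (IsOpenImmersion.isoOfRangeEq (pullback.fst (𝒳 ⊗ 𝒳).hom (specGenericPoint R K))
        ((𝒳 ⊗ 𝒳).hom ⁻¹ᵁ (specGenericPoint R K).opensRange).ι (range_pullbackFst_eq_range_genericFibreOpen_ι R K 𝒳)).inv ≫
      (Functor.OplaxMonoidal.δ (genericFibre R K) 𝒳 𝒳 ≫ (e.hom ⊗ₘ e.hom) ≫ μ[E] ≫ e.inv).left ≫
      pullback.fst 𝒳.hom (specGenericPoint R K) with hg₀def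
  have hg₀ : g₀ ≫ 𝒳.hom = U₀.ι ≫ (𝒳 ⊗ 𝒳).hom := genericMul_comp_hom R K 𝒳 E e
  have hU₀K := preimage_range_subset_genericFibreOpen R K 𝒳
  have hU₀d : Dense (U₀ : Set (𝒳 ⊗ 𝒳).left) := dense_genericFibreOpen R K 𝒳
  -- step 3
  let φ := Scheme.PartialMap.toRationalMap (⟨U₀, hU₀d, g₀⟩ : (𝒳 ⊗ 𝒳).left.PartialMap 𝒳.left)
  haveI := isSeparated_left 𝒳
  refine ⟨(φ.toPartialMap).domain, le_extDomain U₀ hU₀d g₀, (φ.toPartialMap).hom,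
    extHom_comp_hom U₀ hU₀d g₀ hg₀, homOfLE_extHom U₀ hU₀d g₀, ?_⟩
  -- step 4
  obtain ⟨ξ, hξs, hξ1, hξgen⟩ :=
    Literature.AlgebraicGeometry.Morphisms.exists_generic_specialFibre (𝒳 ⊗ 𝒳)
  exact ⟨ξ, mem_domain_of_ringKrullDim_le_one K U₀ hU₀K hU₀d g₀ hg₀ ξ hξ1, hξs, hξ1, hξgen⟩

omit [IsProper 𝒳.hom] in
/-- The total space of `𝒳` is integral (irreducible: `irreducibleSpace_left`; reduced: smooth over
the reduced noetherian `Spec R`). [folklore] -/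
private theorem isIntegral_left : IsIntegral 𝒳.left := by
  haveI : IrreducibleSpace 𝒳.left := irreducibleSpace_left R 𝒳
  haveI : _root_.AlgebraicGeometry.IsReduced 𝒳.left :=
    Literature.AlgebraicGeometry.Resolution.isReduced_of_smooth_of_isReduced_base 𝒳.hom
  exact isIntegral_of_irreducibleSpace_of_isReduced _

omit [IsProper 𝒳.hom] in
/-- **A codimension-`≤ 1` point of the special fibre of `𝒳 ⊗ 𝒳` IS its generic point**: it
specialises to every point of the special fibre. (If `ξ ≠ η_s`, the chain `ξ < η_s < η` in the
specialisation order — `η_s` the generic point of the irreducible special fibre (leaf L1), `η` the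
generic point of the integral total space, which lies over the generic point of `Spec R` — gives
`coheight ξ ≥ 2 = dim 𝒪_ξ`, Mathlib `ringKrullDim_stalk_eq_coheight`.) [folklore] -/
private theorem specializes_of_ringKrullDim_le_one (ξ : (𝒳 ⊗ 𝒳).left)
    (hξs : (𝒳 ⊗ 𝒳).hom.base ξ = IsLocalRing.closedPoint R)
    (hξ1 : ringKrullDim ((𝒳 ⊗ 𝒳).left.presheaf.stalk ξ) ≤ 1) :
    ∀ y : (𝒳 ⊗ 𝒳).left, (𝒳 ⊗ 𝒳).hom.base y = IsLocalRing.closedPoint R → ξ ⤳ y := by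
  haveI : Smooth (𝒳 ⊗ 𝒳).hom := smooth_tensorObj_hom R 𝒳
  haveI : IsIntegral (𝒳 ⊗ 𝒳).left := isIntegral_tensorObj_left R 𝒳
  haveI : GeometricallyIrreducible (𝒳 ⊗ 𝒳).hom := geometricallyIrreducible_tensorObj_hom R 𝒳
  obtain ⟨ζ, hζs, -, hζgen⟩ :=
    Literature.AlgebraicGeometry.Morphisms.exists_generic_specialFibre (𝒳 ⊗ 𝒳)
  suffices hξζ : ξ = ζ by subst hξζ; exact hζgen
  by_contra hne
  -- `ξ < ζ` in the specialisation order (`a ≤ b ↔ b ⤳ a`)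
  have h1 : ξ < ζ := by
    refine ⟨hζgen ξ hξs, fun h => hne ?_⟩
    exact ((hζgen ξ hξs).antisymm h).eq.symm
  -- `ζ < genericPoint` (the generic point lies over the generic point of `Spec R`)
  have hle : ζ ≤ genericPoint (𝒳 ⊗ 𝒳).left := genericPoint_specializes ζ
  have hζtop : ζ < genericPoint (𝒳 ⊗ 𝒳).left := by
    refine ⟨hle, fun h => ?_⟩
    have hζeq : ζ = genericPoint (𝒳 ⊗ 𝒳).left :=
      ((genericPoint_specializes ζ).antisymm h).eq.symm
    have h2 : (𝒳 ⊗ 𝒳).hom.base ζ = genericPoint (Spec (.of R)) := by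
      rw [hζeq]; exact apply_genericPoint_eq
    rw [hζs, genericPoint_eq_bot_of_affine] at h2
    exact IsDiscreteValuationRing.not_a_field R (congrArg PrimeSpectrum.asIdeal h2)
  have h3 : Order.coheight ζ + 1 ≤ Order.coheight ξ := Order.coheight_add_one_le h1
  have h4 : Order.coheight (genericPoint (𝒳 ⊗ 𝒳).left) + 1 ≤ Order.coheight ζ :=
    Order.coheight_add_one_le hζtop
  have h5 : (2 : ℕ∞) ≤ Order.coheight ξ := by
    calc (2 : ℕ∞) = 0 + 1 + 1 := by norm_num
      _ ≤ Order.coheight (genericPoint (𝒳 ⊗ 𝒳).left) + 1 + 1 := by gcongr; exact zero_le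
      _ ≤ Order.coheight ζ + 1 := by gcongr
      _ ≤ Order.coheight ξ := h3
  rw [ringKrullDim_stalk_eq_coheight] at hξ1
  have h6 : (Order.coheight ξ : WithBot ℕ∞) ≤ 1 := hξ1
  have h7 : Order.coheight ξ ≤ 1 := by exact_mod_cast h6
  have : (2 : ℕ∞) ≤ 1 := h5.trans h7
  exact absurd this (by decide)

/-! ### STAGE B (B-p11 g6): the shear on the generic fibre, the `U₀`-chart of `Φ`/`Ψ` -/

omit [IsDomain R] [IsDiscreteValuationRing R] [IsFractionRing R K] [IsOpenImmersion (specGenericPoint R K)] in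
/-- `(𝒳_K-map g).left ≫ pr_B = pr_A ≫ g.left` for the generic-fibre functor. [folklore] -/
private theorem map_left_fst {A B : Over (Spec (.of R))} (g : A ⟶ B) :
    ((genericFibre R K).map g).left ≫ pullback.fst B.hom (specGenericPoint R K) =
      pullback.fst A.hom (specGenericPoint R K) ≫ g.left := by
  simp only [Over.pullback_map_left]
  exact pullback.lift_fst _ _ _

omit [IsDomain R] [IsDiscreteValuationRing R] [IsFractionRing R K] [IsOpenImmersion (specGenericPoint R K)] in
/-- `(𝒳_K-map g).left ≫ pr_{Spec K} = pr_{Spec K}`. [folklore] -/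
private theorem map_left_snd {A B : Over (Spec (.of R))} (g : A ⟶ B) :
    ((genericFibre R K).map g).left ≫ pullback.snd B.hom (specGenericPoint R K) =
      pullback.snd A.hom (specGenericPoint R K) :=
  Over.w ((genericFibre R K).map g)

omit [IsDomain R] [IsDiscreteValuationRing R] [IsFractionRing R K] [Smooth 𝒳.hom] [IsProper 𝒳.hom] [GeometricallyIrreducible 𝒳.hom] in
/-- **(I1) the `U₀`-chart of `Φ = (pr₁, m)`.** For any endomorphism `σ` of the generic fibre
`(𝒳 ⊗ 𝒳)_K` over `Spec K` with `σ ≫ pr₁ = pr₁` and `σ ≫ pr₂ = μ_K` (the generic multiplication read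
through `e`), the morphism `(pr₁|U₀, g₀) : U₀ → 𝒳 ⊗ 𝒳` equals `e₀⁻¹ ≫ σ.left ≫ pr`. [folklore] -/
private theorem lift_fst_genericMul_eq
    (σ : (genericFibre R K).obj (𝒳 ⊗ 𝒳) ⟶ (genericFibre R K).obj (𝒳 ⊗ 𝒳))
    (hσ₁ : σ ≫ (genericFibre R K).map (fst 𝒳 𝒳) = (genericFibre R K).map (fst 𝒳 𝒳))
    (hσ₂ : σ ≫ (genericFibre R K).map (snd 𝒳 𝒳) =
      Functor.OplaxMonoidal.δ (genericFibre R K) 𝒳 𝒳 ≫ (e.hom ⊗ₘ e.hom) ≫ μ[E] ≫ e.inv)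
    (w : (((𝒳 ⊗ 𝒳).hom ⁻¹ᵁ (specGenericPoint R K).opensRange).ι ≫ (fst 𝒳 𝒳).left) ≫ 𝒳.hom =
      ((IsOpenImmersion.isoOfRangeEq (pullback.fst (𝒳 ⊗ 𝒳).hom (specGenericPoint R K))
          ((𝒳 ⊗ 𝒳).hom ⁻¹ᵁ (specGenericPoint R K).opensRange).ι (range_pullbackFst_eq_range_genericFibreOpen_ι R K 𝒳)).inv ≫
        (Functor.OplaxMonoidal.δ (genericFibre R K) 𝒳 𝒳 ≫ (e.hom ⊗ₘ e.hom) ≫ μ[E] ≫ e.inv).left ≫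
        pullback.fst 𝒳.hom (specGenericPoint R K)) ≫ 𝒳.hom) :
    pullback.lift (((𝒳 ⊗ 𝒳).hom ⁻¹ᵁ (specGenericPoint R K).opensRange).ι ≫ (fst 𝒳 𝒳).left)
        ((IsOpenImmersion.isoOfRangeEq (pullback.fst (𝒳 ⊗ 𝒳).hom (specGenericPoint R K))
          ((𝒳 ⊗ 𝒳).hom ⁻¹ᵁ (specGenericPoint R K).opensRange).ι (range_pullbackFst_eq_range_genericFibreOpen_ι R K 𝒳)).inv ≫
        (Functor.OplaxMonoidal.δ (genericFibre R K) 𝒳 𝒳 ≫ (e.hom ⊗ₘ e.hom) ≫ μ[E] ≫ e.inv).left ≫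
        pullback.fst 𝒳.hom (specGenericPoint R K)) w =
      (IsOpenImmersion.isoOfRangeEq (pullback.fst (𝒳 ⊗ 𝒳).hom (specGenericPoint R K))
          ((𝒳 ⊗ 𝒳).hom ⁻¹ᵁ (specGenericPoint R K).opensRange).ι (range_pullbackFst_eq_range_genericFibreOpen_ι R K 𝒳)).inv ≫
        σ.left ≫ pullback.fst (𝒳 ⊗ 𝒳).hom (specGenericPoint R K) := by
  set e₀ := IsOpenImmersion.isoOfRangeEq (pullback.fst (𝒳 ⊗ 𝒳).hom (specGenericPoint R K))
    ((𝒳 ⊗ 𝒳).hom ⁻¹ᵁ (specGenericPoint R K).opensRange).ι (range_pullbackFst_eq_range_genericFibreOpen_ι R K 𝒳) with he₀def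
  have he₀' : e₀.inv ≫ pullback.fst (𝒳 ⊗ 𝒳).hom (specGenericPoint R K) = ((𝒳 ⊗ 𝒳).hom ⁻¹ᵁ (specGenericPoint R K).opensRange).ι :=
    IsOpenImmersion.isoOfRangeEq_inv_fac _ _ _
  -- canonical typings of the `.left` components (objects spelled as `pullback _ _`)
  let σℓ : pullback (𝒳 ⊗ 𝒳).hom (specGenericPoint R K) ⟶ pullback (𝒳 ⊗ 𝒳).hom (specGenericPoint R K) :=
    σ.left
  let f₁ : pullback (𝒳 ⊗ 𝒳).hom (specGenericPoint R K) ⟶ pullback 𝒳.hom (specGenericPoint R K) :=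
    ((genericFibre R K).map (fst 𝒳 𝒳)).left
  let f₂ : pullback (𝒳 ⊗ 𝒳).hom (specGenericPoint R K) ⟶ pullback 𝒳.hom (specGenericPoint R K) :=
    ((genericFibre R K).map (snd 𝒳 𝒳)).left
  let uℓ : pullback (𝒳 ⊗ 𝒳).hom (specGenericPoint R K) ⟶ pullback 𝒳.hom (specGenericPoint R K) :=
    (Functor.OplaxMonoidal.δ (genericFibre R K) 𝒳 𝒳 ≫ (e.hom ⊗ₘ e.hom) ≫ μ[E] ≫ e.inv).left
  have h1 : σℓ ≫ f₁ = f₁ := by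
    change (σ ≫ (genericFibre R K).map (fst 𝒳 𝒳)).left = _
    rw [hσ₁]
  have h2 : σℓ ≫ f₂ = uℓ := by
    change (σ ≫ (genericFibre R K).map (snd 𝒳 𝒳)).left = _
    rw [hσ₂]
  have k1 : f₁ ≫ pullback.fst 𝒳.hom (specGenericPoint R K) =
      pullback.fst (𝒳 ⊗ 𝒳).hom (specGenericPoint R K) ≫ (fst 𝒳 𝒳).left :=
    map_left_fst R K (fst 𝒳 𝒳)
  have k2 : f₂ ≫ pullback.fst 𝒳.hom (specGenericPoint R K) =
      pullback.fst (𝒳 ⊗ 𝒳).hom (specGenericPoint R K) ≫ (snd 𝒳 𝒳).left :=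
    map_left_fst R K (snd 𝒳 𝒳)
  change pullback.lift (((𝒳 ⊗ 𝒳).hom ⁻¹ᵁ (specGenericPoint R K).opensRange).ι ≫ (fst 𝒳 𝒳).left)
      (e₀.inv ≫ uℓ ≫ pullback.fst 𝒳.hom (specGenericPoint R K)) w =
    e₀.inv ≫ σℓ ≫ pullback.fst (𝒳 ⊗ 𝒳).hom (specGenericPoint R K)
  apply pullback.hom_ext
  · rw [pullback.lift_fst]
    change ((𝒳 ⊗ 𝒳).hom ⁻¹ᵁ (specGenericPoint R K).opensRange).ι ≫ (fst 𝒳 𝒳).left =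
      (e₀.inv ≫ σℓ ≫ pullback.fst (𝒳 ⊗ 𝒳).hom (specGenericPoint R K)) ≫ (fst 𝒳 𝒳).left
    rw [← he₀', Category.assoc, Category.assoc, Category.assoc, ← k1, ← Category.assoc σℓ f₁, h1]
  · rw [pullback.lift_snd]
    change e₀.inv ≫ uℓ ≫ pullback.fst 𝒳.hom (specGenericPoint R K) =
      (e₀.inv ≫ σℓ ≫ pullback.fst (𝒳 ⊗ 𝒳).hom (specGenericPoint R K)) ≫ (snd 𝒳 𝒳).left
    rw [Category.assoc, Category.assoc, ← k2, ← Category.assoc σℓ f₂, h2]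

omit [IsDomain R] [IsDiscreteValuationRing R] [IsFractionRing R K] [IsOpenImmersion (specGenericPoint R K)] [Smooth 𝒳.hom] [IsProper 𝒳.hom] [GeometricallyIrreducible 𝒳.hom] in
/-- The **shear** `σ = (pr₁, μ)` of the generic fibre `(𝒳 ⊗ 𝒳)_K`, transported from `E` through
`e` and the monoidal structure of the generic-fibre functor:
`δ ≫ (e ⊗ e) ≫ (pr₁, μ_E) ≫ (e⁻¹ ⊗ e⁻¹) ≫ μ_lax`. Its first component is `pr₁` … [folklore] -/
private theorem shear_fst :
    (Functor.OplaxMonoidal.δ (genericFibre R K) 𝒳 𝒳 ≫ (e.hom ⊗ₘ e.hom) ≫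
        lift (fst E E) μ[E] ≫ (e.inv ⊗ₘ e.inv) ≫ Functor.LaxMonoidal.μ (genericFibre R K) 𝒳 𝒳) ≫
      (genericFibre R K).map (fst 𝒳 𝒳) = (genericFibre R K).map (fst 𝒳 𝒳) := by
  simp only [Category.assoc, Functor.Monoidal.μ_fst, tensorHom_fst, tensorHom_fst_assoc,
    lift_fst_assoc, Iso.hom_inv_id, Category.comp_id, Functor.OplaxMonoidal.δ_fst]

omit [IsDomain R] [IsDiscreteValuationRing R] [IsFractionRing R K] [IsOpenImmersion (specGenericPoint R K)] [Smooth 𝒳.hom] [IsProper 𝒳.hom] [GeometricallyIrreducible 𝒳.hom] in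
/-- … and its second component is the generic multiplication `μ_K = δ ≫ (e ⊗ e) ≫ μ_E ≫ e⁻¹`. [folklore] -/
private theorem shear_snd :
    (Functor.OplaxMonoidal.δ (genericFibre R K) 𝒳 𝒳 ≫ (e.hom ⊗ₘ e.hom) ≫
        lift (fst E E) μ[E] ≫ (e.inv ⊗ₘ e.inv) ≫ Functor.LaxMonoidal.μ (genericFibre R K) 𝒳 𝒳) ≫
      (genericFibre R K).map (snd 𝒳 𝒳) =
      Functor.OplaxMonoidal.δ (genericFibre R K) 𝒳 𝒳 ≫ (e.hom ⊗ₘ e.hom) ≫ μ[E] ≫ e.inv := by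
  simp only [Category.assoc, Functor.Monoidal.μ_snd, tensorHom_snd, lift_snd_assoc]

omit [IsDomain R] [IsDiscreteValuationRing R] [IsFractionRing R K] [IsOpenImmersion (specGenericPoint R K)] [Smooth 𝒳.hom] [IsProper 𝒳.hom] [GeometricallyIrreducible 𝒳.hom] in
/-- The shear is an isomorphism as soon as the shear of `E` is (leaf L5 (i), `stub_isIso_shear`). [folklore] -/
private theorem isIso_shear :
    IsIso (Functor.OplaxMonoidal.δ (genericFibre R K) 𝒳 𝒳 ≫ (e.hom ⊗ₘ e.hom) ≫
        lift (fst E E) μ[E] ≫ (e.inv ⊗ₘ e.inv) ≫ Functor.LaxMonoidal.μ (genericFibre R K) 𝒳 𝒳) := by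
  have h1 : IsIso (Functor.OplaxMonoidal.δ (genericFibre R K) 𝒳 𝒳) := inferInstance
  have h2 : IsIso (e.hom ⊗ₘ e.hom) := inferInstance
  have h3 := Literature.AlgebraicGeometry.GroupSchemes.isIso_lift_fst_mul E
  have h4 : IsIso (e.inv ⊗ₘ e.inv) := inferInstance
  have h5 : IsIso (Functor.LaxMonoidal.μ (genericFibre R K) 𝒳 𝒳) := inferInstance
  exact IsIso.comp_isIso' h1 (IsIso.comp_isIso' h2 (IsIso.comp_isIso' h3 (IsIso.comp_isIso' h4 h5)))

omit [IsDomain R] [IsDiscreteValuationRing R] [IsFractionRing R K] [IsOpenImmersion (specGenericPoint R K)] [Smooth 𝒳.hom] [IsProper 𝒳.hom] [GeometricallyIrreducible 𝒳.hom] in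
/-- The **opposite shear** `σ' = (μ, pr₂)` of the generic fibre: first component `μ_K` … [folklore] -/
private theorem shear'_fst :
    (Functor.OplaxMonoidal.δ (genericFibre R K) 𝒳 𝒳 ≫ (e.hom ⊗ₘ e.hom) ≫
        lift μ[E] (snd E E) ≫ (e.inv ⊗ₘ e.inv) ≫ Functor.LaxMonoidal.μ (genericFibre R K) 𝒳 𝒳) ≫
      (genericFibre R K).map (fst 𝒳 𝒳) =
      Functor.OplaxMonoidal.δ (genericFibre R K) 𝒳 𝒳 ≫ (e.hom ⊗ₘ e.hom) ≫ μ[E] ≫ e.inv := by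
  simp only [Category.assoc, Functor.Monoidal.μ_fst, tensorHom_fst, lift_fst_assoc]

omit [IsDomain R] [IsDiscreteValuationRing R] [IsFractionRing R K] [IsOpenImmersion (specGenericPoint R K)] [Smooth 𝒳.hom] [IsProper 𝒳.hom] [GeometricallyIrreducible 𝒳.hom] in
/-- … second component `pr₂`. [folklore] -/
private theorem shear'_snd :
    (Functor.OplaxMonoidal.δ (genericFibre R K) 𝒳 𝒳 ≫ (e.hom ⊗ₘ e.hom) ≫
        lift μ[E] (snd E E) ≫ (e.inv ⊗ₘ e.inv) ≫ Functor.LaxMonoidal.μ (genericFibre R K) 𝒳 𝒳) ≫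
      (genericFibre R K).map (snd 𝒳 𝒳) = (genericFibre R K).map (snd 𝒳 𝒳) := by
  simp only [Category.assoc, Functor.Monoidal.μ_snd, tensorHom_snd, tensorHom_snd_assoc,
    lift_snd_assoc, Iso.hom_inv_id, Category.comp_id, Functor.OplaxMonoidal.δ_snd]

omit [IsDomain R] [IsDiscreteValuationRing R] [IsFractionRing R K] [IsOpenImmersion (specGenericPoint R K)] [Smooth 𝒳.hom] [IsProper 𝒳.hom] [GeometricallyIrreducible 𝒳.hom] in
/-- The opposite shear is an isomorphism (leaf L5 (i'), `stub_isIso_shear'`). [folklore] -/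
private theorem isIso_shear' :
    IsIso (Functor.OplaxMonoidal.δ (genericFibre R K) 𝒳 𝒳 ≫ (e.hom ⊗ₘ e.hom) ≫
        lift μ[E] (snd E E) ≫ (e.inv ⊗ₘ e.inv) ≫ Functor.LaxMonoidal.μ (genericFibre R K) 𝒳 𝒳) := by
  have h1 : IsIso (Functor.OplaxMonoidal.δ (genericFibre R K) 𝒳 𝒳) := inferInstance
  have h2 : IsIso (e.hom ⊗ₘ e.hom) := inferInstance
  have h3 := Literature.AlgebraicGeometry.GroupSchemes.isIso_lift_mul_snd E
  have h4 : IsIso (e.inv ⊗ₘ e.inv) := inferInstance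
  have h5 : IsIso (Functor.LaxMonoidal.μ (genericFibre R K) 𝒳 𝒳) := inferInstance
  exact IsIso.comp_isIso' h1 (IsIso.comp_isIso' h2 (IsIso.comp_isIso' h3 (IsIso.comp_isIso' h4 h5)))

omit [IsDomain R] [IsDiscreteValuationRing R] [IsFractionRing R K] [Smooth 𝒳.hom] [IsProper 𝒳.hom] [GeometricallyIrreducible 𝒳.hom] in
/-- **(I1′) the `U₀`-chart of `Ψ = (m, pr₂)`**: for any endomorphism `σ'` of `(𝒳 ⊗ 𝒳)_K` over
`Spec K` with `σ' ≫ pr₁ = μ_K` and `σ' ≫ pr₂ = pr₂`, `(g₀, pr₂|U₀) = e₀⁻¹ ≫ σ'.left ≫ pr`. [folklore] -/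
private theorem lift_genericMul_snd_eq
    (σ : (genericFibre R K).obj (𝒳 ⊗ 𝒳) ⟶ (genericFibre R K).obj (𝒳 ⊗ 𝒳))
    (hσ₁ : σ ≫ (genericFibre R K).map (fst 𝒳 𝒳) =
      Functor.OplaxMonoidal.δ (genericFibre R K) 𝒳 𝒳 ≫ (e.hom ⊗ₘ e.hom) ≫ μ[E] ≫ e.inv)
    (hσ₂ : σ ≫ (genericFibre R K).map (snd 𝒳 𝒳) = (genericFibre R K).map (snd 𝒳 𝒳))
    (w : ((IsOpenImmersion.isoOfRangeEq (pullback.fst (𝒳 ⊗ 𝒳).hom (specGenericPoint R K))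
          ((𝒳 ⊗ 𝒳).hom ⁻¹ᵁ (specGenericPoint R K).opensRange).ι (range_pullbackFst_eq_range_genericFibreOpen_ι R K 𝒳)).inv ≫
        (Functor.OplaxMonoidal.δ (genericFibre R K) 𝒳 𝒳 ≫ (e.hom ⊗ₘ e.hom) ≫ μ[E] ≫ e.inv).left ≫
        pullback.fst 𝒳.hom (specGenericPoint R K)) ≫ 𝒳.hom =
      (((𝒳 ⊗ 𝒳).hom ⁻¹ᵁ (specGenericPoint R K).opensRange).ι ≫ (snd 𝒳 𝒳).left) ≫ 𝒳.hom) :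
    pullback.lift
        ((IsOpenImmersion.isoOfRangeEq (pullback.fst (𝒳 ⊗ 𝒳).hom (specGenericPoint R K))
          ((𝒳 ⊗ 𝒳).hom ⁻¹ᵁ (specGenericPoint R K).opensRange).ι (range_pullbackFst_eq_range_genericFibreOpen_ι R K 𝒳)).inv ≫
        (Functor.OplaxMonoidal.δ (genericFibre R K) 𝒳 𝒳 ≫ (e.hom ⊗ₘ e.hom) ≫ μ[E] ≫ e.inv).left ≫
        pullback.fst 𝒳.hom (specGenericPoint R K))
        (((𝒳 ⊗ 𝒳).hom ⁻¹ᵁ (specGenericPoint R K).opensRange).ι ≫ (snd 𝒳 𝒳).left) w =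
      (IsOpenImmersion.isoOfRangeEq (pullback.fst (𝒳 ⊗ 𝒳).hom (specGenericPoint R K))
          ((𝒳 ⊗ 𝒳).hom ⁻¹ᵁ (specGenericPoint R K).opensRange).ι (range_pullbackFst_eq_range_genericFibreOpen_ι R K 𝒳)).inv ≫
        σ.left ≫ pullback.fst (𝒳 ⊗ 𝒳).hom (specGenericPoint R K) := by
  set e₀ := IsOpenImmersion.isoOfRangeEq (pullback.fst (𝒳 ⊗ 𝒳).hom (specGenericPoint R K))
    ((𝒳 ⊗ 𝒳).hom ⁻¹ᵁ (specGenericPoint R K).opensRange).ι (range_pullbackFst_eq_range_genericFibreOpen_ι R K 𝒳) with he₀def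
  have he₀' : e₀.inv ≫ pullback.fst (𝒳 ⊗ 𝒳).hom (specGenericPoint R K) = ((𝒳 ⊗ 𝒳).hom ⁻¹ᵁ (specGenericPoint R K).opensRange).ι :=
    IsOpenImmersion.isoOfRangeEq_inv_fac _ _ _
  let σℓ : pullback (𝒳 ⊗ 𝒳).hom (specGenericPoint R K) ⟶ pullback (𝒳 ⊗ 𝒳).hom (specGenericPoint R K) :=
    σ.left
  let f₁ : pullback (𝒳 ⊗ 𝒳).hom (specGenericPoint R K) ⟶ pullback 𝒳.hom (specGenericPoint R K) :=
    ((genericFibre R K).map (fst 𝒳 𝒳)).left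
  let f₂ : pullback (𝒳 ⊗ 𝒳).hom (specGenericPoint R K) ⟶ pullback 𝒳.hom (specGenericPoint R K) :=
    ((genericFibre R K).map (snd 𝒳 𝒳)).left
  let uℓ : pullback (𝒳 ⊗ 𝒳).hom (specGenericPoint R K) ⟶ pullback 𝒳.hom (specGenericPoint R K) :=
    (Functor.OplaxMonoidal.δ (genericFibre R K) 𝒳 𝒳 ≫ (e.hom ⊗ₘ e.hom) ≫ μ[E] ≫ e.inv).left
  have h1 : σℓ ≫ f₁ = uℓ := by
    change (σ ≫ (genericFibre R K).map (fst 𝒳 𝒳)).left = _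
    rw [hσ₁]
  have h2 : σℓ ≫ f₂ = f₂ := by
    change (σ ≫ (genericFibre R K).map (snd 𝒳 𝒳)).left = _
    rw [hσ₂]
  have k1 : f₁ ≫ pullback.fst 𝒳.hom (specGenericPoint R K) =
      pullback.fst (𝒳 ⊗ 𝒳).hom (specGenericPoint R K) ≫ (fst 𝒳 𝒳).left :=
    map_left_fst R K (fst 𝒳 𝒳)
  have k2 : f₂ ≫ pullback.fst 𝒳.hom (specGenericPoint R K) =
      pullback.fst (𝒳 ⊗ 𝒳).hom (specGenericPoint R K) ≫ (snd 𝒳 𝒳).left :=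
    map_left_fst R K (snd 𝒳 𝒳)
  change pullback.lift (e₀.inv ≫ uℓ ≫ pullback.fst 𝒳.hom (specGenericPoint R K))
      (((𝒳 ⊗ 𝒳).hom ⁻¹ᵁ (specGenericPoint R K).opensRange).ι ≫ (snd 𝒳 𝒳).left) w =
    e₀.inv ≫ σℓ ≫ pullback.fst (𝒳 ⊗ 𝒳).hom (specGenericPoint R K)
  apply pullback.hom_ext
  · rw [pullback.lift_fst]
    change e₀.inv ≫ uℓ ≫ pullback.fst 𝒳.hom (specGenericPoint R K) =
      (e₀.inv ≫ σℓ ≫ pullback.fst (𝒳 ⊗ 𝒳).hom (specGenericPoint R K)) ≫ (fst 𝒳 𝒳).left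
    rw [Category.assoc, Category.assoc, ← k1, ← Category.assoc σℓ f₁, h1]
  · rw [pullback.lift_snd]
    change ((𝒳 ⊗ 𝒳).hom ⁻¹ᵁ (specGenericPoint R K).opensRange).ι ≫ (snd 𝒳 𝒳).left =
      (e₀.inv ≫ σℓ ≫ pullback.fst (𝒳 ⊗ 𝒳).hom (specGenericPoint R K)) ≫ (snd 𝒳 𝒳).left
    rw [← he₀', Category.assoc, Category.assoc, Category.assoc, ← k2, ← Category.assoc σℓ f₂, h2]

/-! ### STAGE B: Zariski-locality (★ p636499 `Morphisms.ZariskiLocalOnSupOfOpens`) -/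

/-- Restricting `(D.ι ≫ a, m)`-type lifts to an open `V ≤ D` (the form in which `core_fst`
states flatness) is precomposition with `homOfLE`. [folklore] -/
private theorem homOfLE_comp_lift {X A B S : Scheme.{u}} {f : A ⟶ S} {g : B ⟶ S} {D V : X.Opens}
    (hVD : V ≤ D) (a : (D : Scheme.{u}) ⟶ A) (b : (D : Scheme.{u}) ⟶ B) (w : a ≫ f = b ≫ g) :
    X.homOfLE hVD ≫ pullback.lift a b w =
      pullback.lift (X.homOfLE hVD ≫ a) (X.homOfLE hVD ≫ b)
        (by rw [Category.assoc, Category.assoc, w]) := by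
  refine pullback.hom_ext ?_ ?_
  · rw [Category.assoc, pullback.lift_fst, pullback.lift_fst]
  · rw [Category.assoc, pullback.lift_snd, pullback.lift_snd]


/-! ### STAGE B: one side (`Φ` or `Ψ`) assembled abstractly -/

omit [IsDomain R] [IsDiscreteValuationRing R] [Smooth 𝒳.hom] [GeometricallyIrreducible 𝒳.hom] in
/-- `𝒳 ⊗ 𝒳 → Spec R` is separated. [folklore] -/
private theorem isSeparated_tensorObj_hom : IsSeparated (𝒳 ⊗ 𝒳).hom := by
  rw [Over.tensorObj_hom]
  exact MorphismProperty.comp_mem _ _ _ (MorphismProperty.pullback_fst _ _ inferInstance)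
    inferInstance

omit [IsDomain R] [IsDiscreteValuationRing R] [IsFractionRing R K] [Smooth 𝒳.hom] [IsProper 𝒳.hom] [GeometricallyIrreducible 𝒳.hom] in
/-- **The `U₀`-chart is an open immersion onto (at least) `U₀`.** For an isomorphism `σ` of the
generic fibre `(𝒳 ⊗ 𝒳)_K`, the composite `e₀⁻¹ ≫ σ.left ≫ pr : U₀ → 𝒳 ⊗ 𝒳` is an open immersion
whose image contains the generic-fibre open `U₀`. [folklore] -/
private theorem chart_isOpenImmersion
    (σ : (genericFibre R K).obj (𝒳 ⊗ 𝒳) ⟶ (genericFibre R K).obj (𝒳 ⊗ 𝒳)) [IsIso σ] :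
    IsOpenImmersion
      ((IsOpenImmersion.isoOfRangeEq (pullback.fst (𝒳 ⊗ 𝒳).hom (specGenericPoint R K))
          ((𝒳 ⊗ 𝒳).hom ⁻¹ᵁ (specGenericPoint R K).opensRange).ι (range_pullbackFst_eq_range_genericFibreOpen_ι R K 𝒳)).inv ≫
        σ.left ≫ pullback.fst (𝒳 ⊗ 𝒳).hom (specGenericPoint R K)) ∧
    (((𝒳 ⊗ 𝒳).hom ⁻¹ᵁ (specGenericPoint R K).opensRange) : Set (𝒳 ⊗ 𝒳).left) ⊆ Set.range
      ((IsOpenImmersion.isoOfRangeEq (pullback.fst (𝒳 ⊗ 𝒳).hom (specGenericPoint R K))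
          ((𝒳 ⊗ 𝒳).hom ⁻¹ᵁ (specGenericPoint R K).opensRange).ι (range_pullbackFst_eq_range_genericFibreOpen_ι R K 𝒳)).inv ≫
        σ.left ≫ pullback.fst (𝒳 ⊗ 𝒳).hom (specGenericPoint R K)).base := by
  set e₀ := IsOpenImmersion.isoOfRangeEq (pullback.fst (𝒳 ⊗ 𝒳).hom (specGenericPoint R K))
    ((𝒳 ⊗ 𝒳).hom ⁻¹ᵁ (specGenericPoint R K).opensRange).ι (range_pullbackFst_eq_range_genericFibreOpen_ι R K 𝒳) with he₀def
  let σℓ : pullback (𝒳 ⊗ 𝒳).hom (specGenericPoint R K) ⟶ pullback (𝒳 ⊗ 𝒳).hom (specGenericPoint R K) :=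
    σ.left
  haveI : IsIso σℓ := (inferInstance : IsIso ((Over.forget _).map σ))
  haveI : IsIso (e₀.inv ≫ σℓ) := IsIso.comp_isIso
  change IsOpenImmersion ((e₀.inv ≫ σℓ) ≫ pullback.fst (𝒳 ⊗ 𝒳).hom (specGenericPoint R K)) ∧
    (((𝒳 ⊗ 𝒳).hom ⁻¹ᵁ (specGenericPoint R K).opensRange) : Set (𝒳 ⊗ 𝒳).left) ⊆
      Set.range ((e₀.inv ≫ σℓ) ≫ pullback.fst (𝒳 ⊗ 𝒳).hom (specGenericPoint R K)).base
  refine ⟨inferInstance, ?_⟩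
  intro y hy
  have hy' : y ∈ Set.range (pullback.fst (𝒳 ⊗ 𝒳).hom (specGenericPoint R K)).base := by
    rw [range_pullbackFst_eq_range_genericFibreOpen_ι, Scheme.Opens.range_ι]
    exact hy
  obtain ⟨z, rfl⟩ := hy'
  refine ⟨(inv (e₀.inv ≫ σℓ)).base z, ?_⟩
  change ((inv (e₀.inv ≫ σℓ) ≫ (e₀.inv ≫ σℓ)) ≫
    pullback.fst (𝒳 ⊗ 𝒳).hom (specGenericPoint R K)).base z = _
  rw [IsIso.inv_hom_id, Category.id_comp]

omit [GeometricallyIrreducible 𝒳.hom] in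
/-- **One side of the birational group law, assembled.** Let `F : D → 𝒳 ⊗ 𝒳` be an `R`-morphism
out of an open `D ⊇ U₀` whose restriction to `U₀` is an open immersion with image `⊇ U₀` (the
generic-fibre chart), and `V ≤ D` an open on which `F` is flat and locally of finite presentation
(the étale heart). Then `F` restricted to `V ⊔ U₀` is an OPEN IMMERSION (Zariski-locality +
leaf L5 / Stacks 081M `stub_L5`). [folklore] -/
private theorem isOpenImmersion_homOfLE_sup {D V : (𝒳 ⊗ 𝒳).left.Opens} (hD : (𝒳 ⊗ 𝒳).hom ⁻¹ᵁ (specGenericPoint R K).opensRange ≤ D)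
    (hVD : V ≤ D) (F : (D : Scheme.{u}) ⟶ (𝒳 ⊗ 𝒳).left)
    (hF : F ≫ (𝒳 ⊗ 𝒳).hom = D.ι ≫ (𝒳 ⊗ 𝒳).hom)
    (hflat : Flat ((𝒳 ⊗ 𝒳).left.homOfLE hVD ≫ F))
    (hlofp : LocallyOfFinitePresentation ((𝒳 ⊗ 𝒳).left.homOfLE hVD ≫ F))
    (σ : (genericFibre R K).obj (𝒳 ⊗ 𝒳) ⟶ (genericFibre R K).obj (𝒳 ⊗ 𝒳)) [IsIso σ]
    (hFchart : (𝒳 ⊗ 𝒳).left.homOfLE hD ≫ F =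
      (IsOpenImmersion.isoOfRangeEq (pullback.fst (𝒳 ⊗ 𝒳).hom (specGenericPoint R K))
          ((𝒳 ⊗ 𝒳).hom ⁻¹ᵁ (specGenericPoint R K).opensRange).ι (range_pullbackFst_eq_range_genericFibreOpen_ι R K 𝒳)).inv ≫
        σ.left ≫ pullback.fst (𝒳 ⊗ 𝒳).hom (specGenericPoint R K)) :
    IsOpenImmersion ((𝒳 ⊗ 𝒳).left.homOfLE (sup_le hVD hD) ≫ F) := by
  obtain ⟨hchart, hsurj⟩ := chart_isOpenImmersion R K 𝒳 σ
  rw [← hFchart] at hchart hsurj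
  haveI : Smooth (𝒳 ⊗ 𝒳).hom := smooth_tensorObj_hom R 𝒳
  haveI : IsSeparated (𝒳 ⊗ 𝒳).hom := isSeparated_tensorObj_hom R 𝒳
  set V' : (𝒳 ⊗ 𝒳).left.Opens := V ⊔ ((𝒳 ⊗ 𝒳).hom ⁻¹ᵁ (specGenericPoint R K).opensRange) with hV'def
  have hV'D : V' ≤ D := sup_le hVD hD
  have hU₀V' : (𝒳 ⊗ 𝒳).hom ⁻¹ᵁ (specGenericPoint R K).opensRange ≤ V' := le_sup_right
  set G : (V' : Scheme.{u}) ⟶ (𝒳 ⊗ 𝒳).left := (𝒳 ⊗ 𝒳).left.homOfLE hV'D ≫ F with hGdef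
  -- flat + lfp on `V'` (Zariski-local), from the two charts
  haveI hGflat : Flat G :=
    of_homOfLE_of_homOfLE @Flat hVD hD F hflat inferInstance
  haveI hGlofp : LocallyOfFinitePresentation G :=
    of_homOfLE_of_homOfLE @LocallyOfFinitePresentation hVD hD F hlofp inferInstance
  -- `G` is a morphism over `R`
  have hGover : G ≫ (𝒳 ⊗ 𝒳).hom = V'.ι ≫ (𝒳 ⊗ 𝒳).hom := by
    rw [hGdef, Category.assoc, hF, ← Category.assoc, Scheme.homOfLE_ι]
  -- the chart equation and the iso over `U₀`
  have hchart' : (𝒳 ⊗ 𝒳).left.homOfLE hU₀V' ≫ G = (𝒳 ⊗ 𝒳).left.homOfLE hD ≫ F := by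
    rw [hGdef, ← Category.assoc, Scheme.homOfLE_homOfLE]
  haveI : IsOpenImmersion ((𝒳 ⊗ 𝒳).left.homOfLE hU₀V' ≫ G) := by rw [hchart']; exact hchart
  have hGpre : G ⁻¹ᵁ ((𝒳 ⊗ 𝒳).hom ⁻¹ᵁ (specGenericPoint R K).opensRange) = V'.ι ⁻¹ᵁ ((𝒳 ⊗ 𝒳).hom ⁻¹ᵁ (specGenericPoint R K).opensRange) := by
    change (G ≫ (𝒳 ⊗ 𝒳).hom) ⁻¹ᵁ (specGenericPoint R K).opensRange =
      (V'.ι ≫ (𝒳 ⊗ 𝒳).hom) ⁻¹ᵁ (specGenericPoint R K).opensRange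
    rw [hGover]
  haveI hiso : IsIso (G ∣_ ((𝒳 ⊗ 𝒳).hom ⁻¹ᵁ (specGenericPoint R K).opensRange)) :=
    isIso_morphismRestrict_of_chart hU₀V' G hGpre (by rw [hchart']; exact hsurj)
  -- Stacks 081M (leaf L5)
  let 𝒱 : Over (Spec (.of R)) := Over.mk (V'.ι ≫ (𝒳 ⊗ 𝒳).hom)
  let Gover : 𝒱 ⟶ 𝒳 ⊗ 𝒳 := Over.homMk G hGover
  haveI : Flat 𝒱.hom := by
    change Flat (V'.ι ≫ (𝒳 ⊗ 𝒳).hom)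
    infer_instance
  haveI : IsSeparated (G ≫ (𝒳 ⊗ 𝒳).hom) := by rw [hGover]; infer_instance
  haveI : IsSeparated Gover.left := IsSeparated.of_comp G (𝒳 ⊗ 𝒳).hom
  haveI : Flat Gover.left := hGflat
  haveI : LocallyOfFinitePresentation Gover.left := hGlofp
  haveI : IsIso (Gover.left ∣_ ((𝒳 ⊗ 𝒳).hom ⁻¹ᵁ (specGenericPoint R K).opensRange)) := hiso
  exact isOpenImmersion_of_flat_of_isIso_morphismRestrict_genericFibre R K Gover


omit [IsDomain R] [IsDiscreteValuationRing R] [IsFractionRing R K] [Smooth 𝒳.hom] [IsProper 𝒳.hom] [GeometricallyIrreducible 𝒳.hom] in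
/-- **The iso over the generic fibre** (the extra binder `hΦiso` of the core): for ANY datum
`(e', D, m)` with `m|U₀ = g₀(e')`, the restriction of `Φ_D = (pr₁, m)` over the generic-fibre open is
an isomorphism — its `U₀`-chart is the transported shear (`lift_fst_genericMul_eq`), an open
immersion onto `U₀` (`chart_isOpenImmersion`), and ★ `Morphisms.isIso_morphismRestrict_of_chart`. [folklore] -/
private theorem isIso_morphismRestrict_liftFst (e' : (genericFibre R K).obj 𝒳 ≅ E)
    {D : (𝒳 ⊗ 𝒳).left.Opens} (hD : ((𝒳 ⊗ 𝒳).hom ⁻¹ᵁ (specGenericPoint R K).opensRange) ≤ D)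
    (m : (D : Scheme.{u}) ⟶ 𝒳.left) (hm : m ≫ 𝒳.hom = D.ι ≫ (𝒳 ⊗ 𝒳).hom)
    (hgen : (𝒳 ⊗ 𝒳).left.homOfLE hD ≫ m =
      (IsOpenImmersion.isoOfRangeEq (pullback.fst (𝒳 ⊗ 𝒳).hom (specGenericPoint R K))
          ((𝒳 ⊗ 𝒳).hom ⁻¹ᵁ (specGenericPoint R K).opensRange).ι (by
            rw [Scheme.Opens.range_ι]
            exact IsOpenImmersion.range_pullbackFst (specGenericPoint R K) (𝒳 ⊗ 𝒳).hom)).inv ≫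
        (Functor.OplaxMonoidal.δ (genericFibre R K) 𝒳 𝒳 ≫ (e'.hom ⊗ₘ e'.hom) ≫ μ[E] ≫ e'.inv).left ≫
        pullback.fst 𝒳.hom (specGenericPoint R K)) :
    IsIso (pullback.lift (D.ι ≫ (fst 𝒳 𝒳).left) m
      (by rw [Category.assoc, Over.w (fst 𝒳 𝒳), hm]) ∣_ ((𝒳 ⊗ 𝒳).hom ⁻¹ᵁ (specGenericPoint R K).opensRange)) := by
  set e₀ := IsOpenImmersion.isoOfRangeEq (pullback.fst (𝒳 ⊗ 𝒳).hom (specGenericPoint R K))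
    ((𝒳 ⊗ 𝒳).hom ⁻¹ᵁ (specGenericPoint R K).opensRange).ι (range_pullbackFst_eq_range_genericFibreOpen_ι R K 𝒳) with he₀def
  set σ := Functor.OplaxMonoidal.δ (genericFibre R K) 𝒳 𝒳 ≫ (e'.hom ⊗ₘ e'.hom) ≫
    lift (fst E E) μ[E] ≫ (e'.inv ⊗ₘ e'.inv) ≫ Functor.LaxMonoidal.μ (genericFibre R K) 𝒳 𝒳 with hσ
  haveI : IsIso σ := isIso_shear R K 𝒳 E e'
  have wΦ : (D.ι ≫ (fst 𝒳 𝒳).left) ≫ 𝒳.hom = m ≫ 𝒳.hom := by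
    rw [Category.assoc, Over.w (fst 𝒳 𝒳), hm]
  let ΦD : (D : Scheme.{u}) ⟶ pullback 𝒳.hom 𝒳.hom := pullback.lift (D.ι ≫ (fst 𝒳 𝒳).left) m wΦ
  have hΦDover : ΦD ≫ (pullback.fst 𝒳.hom 𝒳.hom ≫ 𝒳.hom) = D.ι ≫ (𝒳 ⊗ 𝒳).hom := by
    rw [pullback.lift_fst_assoc, Category.assoc, Over.w (fst 𝒳 𝒳)]
  have hchart : (𝒳 ⊗ 𝒳).left.homOfLE hD ≫ ΦD =
      e₀.inv ≫ σ.left ≫ pullback.fst (𝒳 ⊗ 𝒳).hom (specGenericPoint R K) := by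
    rw [homOfLE_comp_lift]
    simp only [Scheme.homOfLE_ι_assoc, hgen]
    exact lift_fst_genericMul_eq R K 𝒳 E e' σ (shear_fst R K 𝒳 E e') (shear_snd R K 𝒳 E e') _
  obtain ⟨hopen, hsurj⟩ := chart_isOpenImmersion R K 𝒳 σ
  rw [← hchart] at hopen hsurj
  have hpre : ΦD ⁻¹ᵁ ((𝒳 ⊗ 𝒳).hom ⁻¹ᵁ (specGenericPoint R K).opensRange) = D.ι ⁻¹ᵁ ((𝒳 ⊗ 𝒳).hom ⁻¹ᵁ (specGenericPoint R K).opensRange) := by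
    change (ΦD ≫ (pullback.fst 𝒳.hom 𝒳.hom ≫ 𝒳.hom)) ⁻¹ᵁ (specGenericPoint R K).opensRange =
      (D.ι ≫ (𝒳 ⊗ 𝒳).hom) ⁻¹ᵁ (specGenericPoint R K).opensRange
    rw [hΦDover]
  exact @isIso_morphismRestrict_of_chart _ _ _ hD ΦD hpre hopen hsurj

/-- **CORE (Ψ)** — the twin of `core_fst` with `Ψ = (m, pr₂)`; NO LONGER A STUB: derived from
`core_fst` (for the identification `e ≪≫ asIso ι[E]`) by B-p01's `core_snd_of_core_fst`
(★ p635335 `BirationalGroupLawSwap`, transport along the braiding of `Over (Spec R)`), B-p18 12:52:36Z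
«stub_core_snd is RETIRED». [folklore] -/
private theorem coreSnd (n : ℕ) [SmoothOfRelativeDimension n 𝒳.hom] [IsIntegral 𝒳.left]
    [IsIntegral (𝒳 ⊗ 𝒳).left] (D : (𝒳 ⊗ 𝒳).left.Opens) (hD : (𝒳 ⊗ 𝒳).hom ⁻¹ᵁ (specGenericPoint R K).opensRange ≤ D)
    (m : (D : Scheme.{u}) ⟶ 𝒳.left) (hm : m ≫ 𝒳.hom = D.ι ≫ (𝒳 ⊗ 𝒳).hom)
    (hgen : (𝒳 ⊗ 𝒳).left.homOfLE hD ≫ m =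
      (IsOpenImmersion.isoOfRangeEq (pullback.fst (𝒳 ⊗ 𝒳).hom (specGenericPoint R K))
          ((𝒳 ⊗ 𝒳).hom ⁻¹ᵁ (specGenericPoint R K).opensRange).ι (by
            rw [Scheme.Opens.range_ι]
            exact IsOpenImmersion.range_pullbackFst (specGenericPoint R K) (𝒳 ⊗ 𝒳).hom)).inv ≫
        (Functor.OplaxMonoidal.δ (genericFibre R K) 𝒳 𝒳 ≫ (e.hom ⊗ₘ e.hom) ≫ μ[E] ≫ e.inv).left ≫
        pullback.fst 𝒳.hom (specGenericPoint R K))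
    (ξ : (𝒳 ⊗ 𝒳).left) (hξD : ξ ∈ D) (hξs : (𝒳 ⊗ 𝒳).hom.base ξ = IsLocalRing.closedPoint R)
    (hξ1 : ringKrullDim ((𝒳 ⊗ 𝒳).left.presheaf.stalk ξ) ≤ 1) :
    ∃ (V : (𝒳 ⊗ 𝒳).left.Opens) (hVD : V ≤ D), ξ ∈ V ∧
      Flat (pullback.lift ((𝒳 ⊗ 𝒳).left.homOfLE hVD ≫ m) (V.ι ≫ (snd 𝒳 𝒳).left)
        (by rw [Category.assoc, Category.assoc, hm, Over.w (snd 𝒳 𝒳), ← Category.assoc,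
              Scheme.homOfLE_ι]) :
        (V : Scheme.{u}) ⟶ pullback 𝒳.hom 𝒳.hom) ∧
      LocallyOfFinitePresentation (pullback.lift ((𝒳 ⊗ 𝒳).left.homOfLE hVD ≫ m)
        (V.ι ≫ (snd 𝒳 𝒳).left)
        (by rw [Category.assoc, Category.assoc, hm, Over.w (snd 𝒳 𝒳), ← Category.assoc,
              Scheme.homOfLE_ι])) :=
  -- CLOSED (B-p18 12:52:36Z: stub retired) by B-p01's `core_snd_of_core_fst` over `core_fst`
  Literature.AlgebraicGeometry.GroupSchemes.BirationalGroupLawSwap.core_snd_of_core_fst R K 𝒳 E e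
    (fun e' D' hD' m' hm' hgen' ξ' hξ'D hξ's hξ'1 =>
      Literature.NumberTheory.DiophantineGeometry.SmoothProperModelBirationalGroupLawCore.core_fst
        R K 𝒳 n E e' D' hD' m' hm' hgen' ξ' hξ'D hξ's hξ'1
        (specializes_of_ringKrullDim_le_one R 𝒳 ξ' hξ's hξ'1)
      (isIso_morphismRestrict_liftFst R K 𝒳 E e' hD' m' hm' hgen')) D hD m hm hgen ξ hξD hξs hξ1

/-! ### STAGE B: the generic fibre of the extended multiplication -/

omit [IsDomain R] [IsDiscreteValuationRing R] [IsFractionRing R K] [Smooth 𝒳.hom] [IsProper 𝒳.hom] [GeometricallyIrreducible 𝒳.hom] in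
/-- **Compatibility clause.** If `m : D → 𝒳` restricts to the generic multiplication `g₀` on
`U₀ ⊆ U ⊆ D`, then the generic fibre of `m|U` is, through `e`, the multiplication of `E`
composed with `(U)_K → (𝒳 ⊗ 𝒳)_K ≅ 𝒳_K ⊗ 𝒳_K ≅ E ⊗ E`. [folklore] -/
private theorem genericFibre_map_homOfLE_mul {D U : (𝒳 ⊗ 𝒳).left.Opens} (hD : (𝒳 ⊗ 𝒳).hom ⁻¹ᵁ (specGenericPoint R K).opensRange ≤ D)
    (hU₀U : (𝒳 ⊗ 𝒳).hom ⁻¹ᵁ (specGenericPoint R K).opensRange ≤ U) (hUD : U ≤ D) (m : (D : Scheme.{u}) ⟶ 𝒳.left)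
    (hgen : (𝒳 ⊗ 𝒳).left.homOfLE hD ≫ m = ((IsOpenImmersion.isoOfRangeEq (pullback.fst (𝒳 ⊗ 𝒳).hom (specGenericPoint R K))
          ((𝒳 ⊗ 𝒳).hom ⁻¹ᵁ (specGenericPoint R K).opensRange).ι (range_pullbackFst_eq_range_genericFibreOpen_ι R K 𝒳)).inv ≫
        (Functor.OplaxMonoidal.δ (genericFibre R K) 𝒳 𝒳 ≫ (e.hom ⊗ₘ e.hom) ≫ μ[E] ≫ e.inv).left ≫
        pullback.fst 𝒳.hom (specGenericPoint R K)))
    (hmU : ((𝒳 ⊗ 𝒳).left.homOfLE hUD ≫ m) ≫ 𝒳.hom = U.ι ≫ (𝒳 ⊗ 𝒳).hom) :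
    (genericFibre R K).map (Over.homMk ((𝒳 ⊗ 𝒳).left.homOfLE hUD ≫ m) hmU :
        Over.mk (U.ι ≫ (𝒳 ⊗ 𝒳).hom) ⟶ 𝒳) ≫ e.hom =
      (genericFibre R K).map (Over.homMk U.ι rfl : Over.mk (U.ι ≫ (𝒳 ⊗ 𝒳).hom) ⟶ 𝒳 ⊗ 𝒳) ≫
        Functor.OplaxMonoidal.δ (genericFibre R K) 𝒳 𝒳 ≫ (e.hom ⊗ₘ e.hom) ≫ μ[E] := by
  set U₀ : (𝒳 ⊗ 𝒳).left.Opens := ((𝒳 ⊗ 𝒳).hom ⁻¹ᵁ (specGenericPoint R K).opensRange) with hU₀def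
  set e₀ := IsOpenImmersion.isoOfRangeEq (pullback.fst (𝒳 ⊗ 𝒳).hom (specGenericPoint R K))
    ((𝒳 ⊗ 𝒳).hom ⁻¹ᵁ (specGenericPoint R K).opensRange).ι (range_pullbackFst_eq_range_genericFibreOpen_ι R K 𝒳) with he₀def
  have he₀ : e₀.hom ≫ U₀.ι = pullback.fst (𝒳 ⊗ 𝒳).hom (specGenericPoint R K) :=
    IsOpenImmersion.isoOfRangeEq_hom_fac _ _ _
  set μK : (genericFibre R K).obj (𝒳 ⊗ 𝒳) ⟶ (genericFibre R K).obj 𝒳 :=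
    Functor.OplaxMonoidal.δ (genericFibre R K) 𝒳 𝒳 ≫ (e.hom ⊗ₘ e.hom) ≫ μ[E] ≫ e.inv with hμKdef
  set mU' : Over.mk (U.ι ≫ (𝒳 ⊗ 𝒳).hom) ⟶ 𝒳 := Over.homMk ((𝒳 ⊗ 𝒳).left.homOfLE hUD ≫ m) hmU
    with hmU'def
  set ιU' : Over.mk (U.ι ≫ (𝒳 ⊗ 𝒳).hom) ⟶ 𝒳 ⊗ 𝒳 := Over.homMk U.ι rfl with hιU'def
  suffices S : (genericFibre R K).map mU' = (genericFibre R K).map ιU' ≫ μK by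
    rw [S, hμKdef]
    simp only [Category.assoc, Iso.inv_hom_id, Category.comp_id]
  -- compare `.left` components, with canonical typings
  let a : pullback (U.ι ≫ (𝒳 ⊗ 𝒳).hom) (specGenericPoint R K) ⟶
      pullback 𝒳.hom (specGenericPoint R K) := ((genericFibre R K).map mU').left
  let b : pullback (U.ι ≫ (𝒳 ⊗ 𝒳).hom) (specGenericPoint R K) ⟶
      pullback (𝒳 ⊗ 𝒳).hom (specGenericPoint R K) := ((genericFibre R K).map ιU').left
  let uℓ : pullback (𝒳 ⊗ 𝒳).hom (specGenericPoint R K) ⟶ pullback 𝒳.hom (specGenericPoint R K) :=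
    μK.left
  ext : 1
  change a = b ≫ uℓ
  have ha1 : a ≫ pullback.fst 𝒳.hom (specGenericPoint R K) =
      pullback.fst (U.ι ≫ (𝒳 ⊗ 𝒳).hom) (specGenericPoint R K) ≫
        ((𝒳 ⊗ 𝒳).left.homOfLE hUD ≫ m) := map_left_fst R K mU'
  have ha2 : a ≫ pullback.snd 𝒳.hom (specGenericPoint R K) =
      pullback.snd (U.ι ≫ (𝒳 ⊗ 𝒳).hom) (specGenericPoint R K) := map_left_snd R K mU'
  have hb1 : b ≫ pullback.fst (𝒳 ⊗ 𝒳).hom (specGenericPoint R K) =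
      pullback.fst (U.ι ≫ (𝒳 ⊗ 𝒳).hom) (specGenericPoint R K) ≫ U.ι := map_left_fst R K ιU'
  have hb2 : b ≫ pullback.snd (𝒳 ⊗ 𝒳).hom (specGenericPoint R K) =
      pullback.snd (U.ι ≫ (𝒳 ⊗ 𝒳).hom) (specGenericPoint R K) := map_left_snd R K ιU'
  have hu2 : uℓ ≫ pullback.snd 𝒳.hom (specGenericPoint R K) =
      pullback.snd (𝒳 ⊗ 𝒳).hom (specGenericPoint R K) := Over.w μK
  -- the first projection of `U_K` lands in `U₀`
  set lam := pullback.fst (U.ι ≫ (𝒳 ⊗ 𝒳).hom) (specGenericPoint R K) with hlamdef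
  have hlam : Set.range (lam ≫ U.ι).base ⊆ Set.range U₀.ι.base := by
    rintro _ ⟨z, rfl⟩
    rw [Scheme.Opens.range_ι]
    apply preimage_range_subset_genericFibreOpen R K 𝒳
    change (((lam ≫ U.ι) ≫ (𝒳 ⊗ 𝒳).hom).base z) ∈ Set.range (specGenericPoint R K).base
    rw [Category.assoc, hlamdef, pullback.condition]
    exact ⟨_, rfl⟩
  let lam₀ : pullback (U.ι ≫ (𝒳 ⊗ 𝒳).hom) (specGenericPoint R K) ⟶ (U₀ : Scheme.{u}) :=
    IsOpenImmersion.lift U₀.ι (lam ≫ U.ι) hlam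
  have hlam₀ : lam₀ ≫ U₀.ι = lam ≫ U.ι := IsOpenImmersion.lift_fac _ _ _
  have hlam₀' : lam₀ ≫ (𝒳 ⊗ 𝒳).left.homOfLE hU₀U = lam := by
    rw [← cancel_mono U.ι, Category.assoc, Scheme.homOfLE_ι, hlam₀]
  have hbl : b ≫ e₀.hom = lam₀ := by
    rw [← cancel_mono U₀.ι, Category.assoc, he₀, hb1, hlam₀]
  apply pullback.hom_ext
  · rw [ha1, Category.assoc]
    calc lam ≫ (𝒳 ⊗ 𝒳).left.homOfLE hUD ≫ m
        = lam₀ ≫ ((𝒳 ⊗ 𝒳).left.homOfLE hU₀U ≫ (𝒳 ⊗ 𝒳).left.homOfLE hUD) ≫ m := by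
          rw [← hlam₀']; simp only [Category.assoc]
      _ = lam₀ ≫ ((𝒳 ⊗ 𝒳).left.homOfLE hD ≫ m) := by rw [Scheme.homOfLE_homOfLE]
      _ = lam₀ ≫ e₀.inv ≫ uℓ ≫ pullback.fst 𝒳.hom (specGenericPoint R K) := by rw [hgen]; rfl
      _ = (b ≫ uℓ) ≫ pullback.fst 𝒳.hom (specGenericPoint R K) := by
          rw [← hbl]; simp only [Category.assoc, Iso.hom_inv_id_assoc]
  · rw [ha2, Category.assoc, hu2, hb2]

/-! ### THE HEAD — `exists_birationalGroupLaw_of_smooth_proper` assembled from the stubs -/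

/-- **(W0) — the group law of `E` is an `R`-birational group law on the smooth proper model `𝒳`**
(Edixhoven–Romagny arXiv:1204.1799 Thm. 6.3 / BLR §4.3 with Def. 5.1/1; text = B-p18's
`W0Statement.B-p18g7.lean`), ASSEMBLED (leaf LA) from the leaves `stub_L1` (★ p632508),
`stub_isIso_shear`/`stub_isIso_shear'`, `stub_L5` (081M), `core_fst`/`stub_core_snd` (the
étale heart): `U = (V_Φ ⊔ U₀) ⊓ (V_Ψ ⊔ U₀)` inside the domain of definition of the rational map
defined by the generic multiplication, `m` its maximal extension.
[cite: EdixhovenRomagny2012, Thm. 6.3] [cite: BLRNeronModels1990, §4.3 and Def. 5.1/1] -/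
theorem exists_birationalGroupLaw_of_smooth_proper :
    ∃ (U : (𝒳 ⊗ 𝒳).left.Opens) (m : (U : Scheme.{u}) ⟶ 𝒳.left)
      (hm : m ≫ 𝒳.hom = U.ι ≫ (𝒳 ⊗ 𝒳).hom),
      (𝒳 ⊗ 𝒳).hom.base ⁻¹' Set.range (specGenericPoint R K).base ⊆ (U : Set (𝒳 ⊗ 𝒳).left) ∧
      (∃ u : (𝒳 ⊗ 𝒳).left, u ∈ U ∧ (𝒳 ⊗ 𝒳).hom.base u = IsLocalRing.closedPoint R) ∧
      (genericFibre R K).map (Over.homMk m hm : Over.mk (U.ι ≫ (𝒳 ⊗ 𝒳).hom) ⟶ 𝒳) ≫ e.hom =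
        (genericFibre R K).map (Over.homMk U.ι rfl : Over.mk (U.ι ≫ (𝒳 ⊗ 𝒳).hom) ⟶ 𝒳 ⊗ 𝒳) ≫
          Functor.OplaxMonoidal.δ (genericFibre R K) 𝒳 𝒳 ≫ (e.hom ⊗ₘ e.hom) ≫ μ[E] ∧
      (let Φ : Over.mk (U.ι ≫ (𝒳 ⊗ 𝒳).hom) ⟶ 𝒳 ⊗ 𝒳 :=
          lift (Over.homMk U.ι rfl ≫ fst 𝒳 𝒳) (Over.homMk m hm);
        IsOpenImmersion Φ.left ∧
          (𝒳 ⊗ 𝒳).hom.base ⁻¹' Set.range (specGenericPoint R K).base ⊆ Set.range Φ.left.base) ∧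
      (let Ψ : Over.mk (U.ι ≫ (𝒳 ⊗ 𝒳).hom) ⟶ 𝒳 ⊗ 𝒳 :=
          lift (Over.homMk m hm) (Over.homMk U.ι rfl ≫ snd 𝒳 𝒳);
        IsOpenImmersion Ψ.left ∧
          (𝒳 ⊗ 𝒳).hom.base ⁻¹' Set.range (specGenericPoint R K).base ⊆ Set.range Ψ.left.base) := by
  haveI : Smooth (𝒳 ⊗ 𝒳).hom := smooth_tensorObj_hom R 𝒳
  haveI : IsSeparated (𝒳 ⊗ 𝒳).hom := isSeparated_tensorObj_hom R 𝒳
  set U₀ : (𝒳 ⊗ 𝒳).left.Opens := ((𝒳 ⊗ 𝒳).hom ⁻¹ᵁ (specGenericPoint R K).opensRange) with hU₀def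
  set e₀ := IsOpenImmersion.isoOfRangeEq (pullback.fst (𝒳 ⊗ 𝒳).hom (specGenericPoint R K))
    ((𝒳 ⊗ 𝒳).hom ⁻¹ᵁ (specGenericPoint R K).opensRange).ι (range_pullbackFst_eq_range_genericFibreOpen_ι R K 𝒳) with he₀def
  set μK : (genericFibre R K).obj (𝒳 ⊗ 𝒳) ⟶ (genericFibre R K).obj 𝒳 :=
    Functor.OplaxMonoidal.δ (genericFibre R K) 𝒳 𝒳 ≫ (e.hom ⊗ₘ e.hom) ≫ μ[E] ≫ e.inv with hμKdef
  -- Steps 1–4: domain of definition, extension, a codimension-one point of the special fibre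
  haveI : IsIntegral 𝒳.left := isIntegral_left R 𝒳
  haveI : IsIntegral (𝒳 ⊗ 𝒳).left := isIntegral_tensorObj_left R 𝒳
  haveI : IrreducibleSpace 𝒳.left := irreducibleSpace_left R 𝒳
  obtain ⟨n, hn⟩ :=
    Literature.AlgebraicGeometry.Motives.exists_smoothOfRelativeDimension_of_smooth 𝒳.hom
  haveI := hn
  obtain ⟨D, hD, m, hm, hgen, ξ, hξD, hξs, hξ1, hξgen⟩ := exists_mulDomain R K 𝒳 E e
  have hg₀ := genericMul_comp_hom R K 𝒳 E e
  -- the two shears of the generic fibre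
  set σ := Functor.OplaxMonoidal.δ (genericFibre R K) 𝒳 𝒳 ≫ (e.hom ⊗ₘ e.hom) ≫
    lift (fst E E) μ[E] ≫ (e.inv ⊗ₘ e.inv) ≫ Functor.LaxMonoidal.μ (genericFibre R K) 𝒳 𝒳 with hσ
  set σ' := Functor.OplaxMonoidal.δ (genericFibre R K) 𝒳 𝒳 ≫ (e.hom ⊗ₘ e.hom) ≫
    lift μ[E] (snd E E) ≫ (e.inv ⊗ₘ e.inv) ≫ Functor.LaxMonoidal.μ (genericFibre R K) 𝒳 𝒳 with hσ'
  haveI : IsIso σ := isIso_shear R K 𝒳 E e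
  haveI : IsIso σ' := isIso_shear' R K 𝒳 E e
  -- `Φ_D = (pr₁, m)` and `Ψ_D = (m, pr₂)` on the whole domain `D`
  have wΦ : (D.ι ≫ (fst 𝒳 𝒳).left) ≫ 𝒳.hom = m ≫ 𝒳.hom := by
    rw [Category.assoc, Over.w (fst 𝒳 𝒳), hm]
  have wΨ : m ≫ 𝒳.hom = (D.ι ≫ (snd 𝒳 𝒳).left) ≫ 𝒳.hom := by
    rw [Category.assoc, Over.w (snd 𝒳 𝒳), hm]
  let ΦD : (D : Scheme.{u}) ⟶ pullback 𝒳.hom 𝒳.hom := pullback.lift (D.ι ≫ (fst 𝒳 𝒳).left) m wΦ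
  let ΨD : (D : Scheme.{u}) ⟶ pullback 𝒳.hom 𝒳.hom := pullback.lift m (D.ι ≫ (snd 𝒳 𝒳).left) wΨ
  have hΦDover : ΦD ≫ (pullback.fst 𝒳.hom 𝒳.hom ≫ 𝒳.hom) = D.ι ≫ (𝒳 ⊗ 𝒳).hom := by
    rw [pullback.lift_fst_assoc, Category.assoc, Over.w (fst 𝒳 𝒳)]
  have hΨDover : ΨD ≫ (pullback.fst 𝒳.hom 𝒳.hom ≫ 𝒳.hom) = D.ι ≫ (𝒳 ⊗ 𝒳).hom := by
    rw [pullback.lift_fst_assoc, hm]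
  -- the étale heart (stubs CORE): flat + lfp neighbourhoods of `ξ`
  obtain ⟨V₁, hV₁D, hξV₁, hflat₁, hlofp₁⟩ :=
    Literature.NumberTheory.DiophantineGeometry.SmoothProperModelBirationalGroupLawCore.core_fst R K 𝒳 n E e D hD m hm hgen
      ξ hξD hξs hξ1 hξgen
      (isIso_morphismRestrict_liftFst R K 𝒳 E e hD m hm hgen)
  obtain ⟨V₂, hV₂D, hξV₂, hflat₂, hlofp₂⟩ :=
    coreSnd R K 𝒳 E e n D hD m hm hgen ξ hξD hξs hξ1
  have eΦ₁ : (𝒳 ⊗ 𝒳).left.homOfLE hV₁D ≫ ΦD =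
      pullback.lift (V₁.ι ≫ (fst 𝒳 𝒳).left) ((𝒳 ⊗ 𝒳).left.homOfLE hV₁D ≫ m)
        (by rw [Category.assoc, Over.w (fst 𝒳 𝒳), Category.assoc, hm, ← Category.assoc,
              Scheme.homOfLE_ι]) := by
    rw [homOfLE_comp_lift]
    simp only [Scheme.homOfLE_ι_assoc]
  have eΨ₂ : (𝒳 ⊗ 𝒳).left.homOfLE hV₂D ≫ ΨD =
      pullback.lift ((𝒳 ⊗ 𝒳).left.homOfLE hV₂D ≫ m) (V₂.ι ≫ (snd 𝒳 𝒳).left)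
        (by rw [Category.assoc, Category.assoc, hm, Over.w (snd 𝒳 𝒳), ← Category.assoc,
              Scheme.homOfLE_ι]) := by
    rw [homOfLE_comp_lift]
    simp only [Scheme.homOfLE_ι_assoc]
  have hflatΦ : Flat ((𝒳 ⊗ 𝒳).left.homOfLE hV₁D ≫ ΦD) := by rw [eΦ₁]; exact hflat₁
  have hlofpΦ : LocallyOfFinitePresentation ((𝒳 ⊗ 𝒳).left.homOfLE hV₁D ≫ ΦD) := by
    rw [eΦ₁]; exact hlofp₁
  have hflatΨ : Flat ((𝒳 ⊗ 𝒳).left.homOfLE hV₂D ≫ ΨD) := by rw [eΨ₂]; exact hflat₂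
  have hlofpΨ : LocallyOfFinitePresentation ((𝒳 ⊗ 𝒳).left.homOfLE hV₂D ≫ ΨD) := by
    rw [eΨ₂]; exact hlofp₂
  -- the generic-fibre charts of `Φ_D` and `Ψ_D`
  have hΦchart : (𝒳 ⊗ 𝒳).left.homOfLE hD ≫ ΦD =
      e₀.inv ≫ σ.left ≫ pullback.fst (𝒳 ⊗ 𝒳).hom (specGenericPoint R K) := by
    rw [homOfLE_comp_lift]
    simp only [Scheme.homOfLE_ι_assoc, hgen]
    exact lift_fst_genericMul_eq R K 𝒳 E e σ (shear_fst R K 𝒳 E e) (shear_snd R K 𝒳 E e) _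
  have hΨchart : (𝒳 ⊗ 𝒳).left.homOfLE hD ≫ ΨD =
      e₀.inv ≫ σ'.left ≫ pullback.fst (𝒳 ⊗ 𝒳).hom (specGenericPoint R K) := by
    rw [homOfLE_comp_lift]
    simp only [Scheme.homOfLE_ι_assoc, hgen]
    exact lift_genericMul_snd_eq R K 𝒳 E e σ' (shear'_fst R K 𝒳 E e) (shear'_snd R K 𝒳 E e) _
  -- each side is an open immersion on `V_i ⊔ U₀` (Zariski-locality + iso over `U₀` + 081M)
  have hΦopen : IsOpenImmersion ((𝒳 ⊗ 𝒳).left.homOfLE (sup_le hV₁D hD) ≫ ΦD) :=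
    isOpenImmersion_homOfLE_sup R K 𝒳 hD hV₁D ΦD hΦDover hflatΦ hlofpΦ σ hΦchart
  have hΨopen : IsOpenImmersion ((𝒳 ⊗ 𝒳).left.homOfLE (sup_le hV₂D hD) ≫ ΨD) :=
    isOpenImmersion_homOfLE_sup R K 𝒳 hD hV₂D ΨD hΨDover hflatΨ hlofpΨ σ' hΨchart
  -- surjectivity of the charts onto `U₀`
  have hΦsurj := (chart_isOpenImmersion R K 𝒳 σ).2
  have hΨsurj := (chart_isOpenImmersion R K 𝒳 σ').2
  -- the common open `U`
  set U : (𝒳 ⊗ 𝒳).left.Opens := (V₁ ⊔ U₀) ⊓ (V₂ ⊔ U₀) with hUdef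
  have hU₁ : U ≤ V₁ ⊔ U₀ := inf_le_left
  have hU₂ : U ≤ V₂ ⊔ U₀ := inf_le_right
  have hUD : U ≤ D := hU₁.trans (sup_le hV₁D hD)
  have hU₀U : U₀ ≤ U := le_inf le_sup_right le_sup_right
  have hmU : ((𝒳 ⊗ 𝒳).left.homOfLE hUD ≫ m) ≫ 𝒳.hom = U.ι ≫ (𝒳 ⊗ 𝒳).hom := by
    rw [Category.assoc, hm, ← Category.assoc, Scheme.homOfLE_ι]
  refine ⟨U, (𝒳 ⊗ 𝒳).left.homOfLE hUD ≫ m, hmU, fun y hy => hU₀U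
    (preimage_range_subset_genericFibreOpen R K 𝒳 hy), ⟨ξ, ⟨Or.inl hξV₁, Or.inl hξV₂⟩, hξs⟩,
    genericFibre_map_homOfLE_mul R K 𝒳 E e hD hU₀U hUD m hgen hmU, ?_, ?_⟩
  · -- Φ
    have eΦU : pullback.lift (U.ι ≫ (fst 𝒳 𝒳).left) ((𝒳 ⊗ 𝒳).left.homOfLE hUD ≫ m)
          (by rw [Category.assoc, Over.w (fst 𝒳 𝒳), hmU]) =
        (𝒳 ⊗ 𝒳).left.homOfLE hU₁ ≫ ((𝒳 ⊗ 𝒳).left.homOfLE (sup_le hV₁D hD) ≫ ΦD) := by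
      have e1 : (𝒳 ⊗ 𝒳).left.homOfLE hUD ≫ ΦD =
          (𝒳 ⊗ 𝒳).left.homOfLE hU₁ ≫ ((𝒳 ⊗ 𝒳).left.homOfLE (sup_le hV₁D hD) ≫ ΦD) := by
        rw [← Category.assoc, Scheme.homOfLE_homOfLE]
      rw [← e1, homOfLE_comp_lift]
      simp only [Scheme.homOfLE_ι_assoc]
    show IsOpenImmersion (pullback.lift (U.ι ≫ (fst 𝒳 𝒳).left) ((𝒳 ⊗ 𝒳).left.homOfLE hUD ≫ m)
        (by rw [Category.assoc, Over.w (fst 𝒳 𝒳), hmU])) ∧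
      (𝒳 ⊗ 𝒳).hom.base ⁻¹' Set.range (specGenericPoint R K).base ⊆
        Set.range (pullback.lift (U.ι ≫ (fst 𝒳 𝒳).left) ((𝒳 ⊗ 𝒳).left.homOfLE hUD ≫ m)
          (by rw [Category.assoc, Over.w (fst 𝒳 𝒳), hmU])).base
    rw [eΦU]
    haveI := hΦopen
    refine ⟨inferInstance, fun y hy => ?_⟩
    obtain ⟨x, hx⟩ := hΦsurj (preimage_range_subset_genericFibreOpen R K 𝒳 hy)
    refine ⟨((𝒳 ⊗ 𝒳).left.homOfLE hU₀U).base x, ?_⟩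
    change (((𝒳 ⊗ 𝒳).left.homOfLE hU₀U ≫ (𝒳 ⊗ 𝒳).left.homOfLE hU₁ ≫
      (𝒳 ⊗ 𝒳).left.homOfLE (sup_le hV₁D hD) ≫ ΦD).base x) = y
    rw [Scheme.homOfLE_homOfLE_assoc, Scheme.homOfLE_homOfLE_assoc, hΦchart]
    exact hx
  · -- Ψ
    have eΨU : pullback.lift ((𝒳 ⊗ 𝒳).left.homOfLE hUD ≫ m) (U.ι ≫ (snd 𝒳 𝒳).left)
          (by rw [hmU, Category.assoc, Over.w (snd 𝒳 𝒳)]) =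
        (𝒳 ⊗ 𝒳).left.homOfLE hU₂ ≫ ((𝒳 ⊗ 𝒳).left.homOfLE (sup_le hV₂D hD) ≫ ΨD) := by
      have e2 : (𝒳 ⊗ 𝒳).left.homOfLE hUD ≫ ΨD =
          (𝒳 ⊗ 𝒳).left.homOfLE hU₂ ≫ ((𝒳 ⊗ 𝒳).left.homOfLE (sup_le hV₂D hD) ≫ ΨD) := by
        rw [← Category.assoc, Scheme.homOfLE_homOfLE]
      rw [← e2, homOfLE_comp_lift]
      simp only [Scheme.homOfLE_ι_assoc]
    show IsOpenImmersion (pullback.lift ((𝒳 ⊗ 𝒳).left.homOfLE hUD ≫ m) (U.ι ≫ (snd 𝒳 𝒳).left)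
        (by rw [hmU, Category.assoc, Over.w (snd 𝒳 𝒳)])) ∧
      (𝒳 ⊗ 𝒳).hom.base ⁻¹' Set.range (specGenericPoint R K).base ⊆
        Set.range (pullback.lift ((𝒳 ⊗ 𝒳).left.homOfLE hUD ≫ m) (U.ι ≫ (snd 𝒳 𝒳).left)
          (by rw [hmU, Category.assoc, Over.w (snd 𝒳 𝒳)])).base
    rw [eΨU]
    haveI := hΨopen
    refine ⟨inferInstance, fun y hy => ?_⟩
    obtain ⟨x, hx⟩ := hΨsurj (preimage_range_subset_genericFibreOpen R K 𝒳 hy)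
    refine ⟨((𝒳 ⊗ 𝒳).left.homOfLE hU₀U).base x, ?_⟩
    change (((𝒳 ⊗ 𝒳).left.homOfLE hU₀U ≫ (𝒳 ⊗ 𝒳).left.homOfLE hU₂ ≫
      (𝒳 ⊗ 𝒳).left.homOfLE (sup_le hV₂D hD) ≫ ΨD).base x) = y
    rw [Scheme.homOfLE_homOfLE_assoc, Scheme.homOfLE_homOfLE_assoc, hΨchart]
    exact hx

end Assembly

end Literature.NumberTheory.DiophantineGeometry.SmoothProperModelBirationalGroupLaw

end
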